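import Literature.MathematicalPhysics.QuantumFieldTheory.Balaban1983to89.Node00.Record13LettersOfThm1CCMWZB
import Literature.MathematicalPhysics.QuantumFieldTheory.Balaban1983to89.Node00.Record13NumericsOfThm1CCMWZBChi

/-!
# NODE 00 — OP 5a MODULE #1 (dag-lead g40 HANDS-3 H3.1, director-ym №478): THE 38 LETTERS OF THE GAUGE ROAD AT DEF-1's DOOR WITNESS IN THE χ SLOT — `θ₁₅ᶜᶜᴹᵂᶻᴮ(j; γ; εbg)[χ] =
# theta13OfThm1CCMWZBChi … χ` — AND AT THE RE-CENTRED WITNESS `theta13OfThm1CCMWZBAx …` (β-slot `χ^{(2.9)}_{k,ax}`): `Record13LettersOfThm1CCMWZB` §0–§6′ RE-ISSUED BY THE σ-RECIPE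
# OF [Ax-3b] `Node00/Record13Chi` (χ-generic rows `…_chi`, one-line re-centred instances `…CCMWZBAx…` OF THE SAME ARITY AS THE BARE NAMES), with §0⁺ the FOUR θ-GENERIC HISTORY ROWS
# that read the running coupling ∕ the β-functions of record, χ-generic (13e ∕ 14d ∕ sign-free §3 ∕ `bg_numerics_of_letters`)

Cell `pub-ymgap`, seat `pub-ymgap-node00-def-Y` (g34; Node00 custodian ∕ definer), count-neutral.  [I] = [Balaban1987RG1], [III] = [Balaban1988Convergent], [IV] = [Balaban1989LargeFieldI],
[V] = [Balaban1989LargeFieldII], [B11] = [Balaban1985Variational], [RS] = [Balaban1985RegularSpaces].  dag-n07-w3 g22's σ-closure of the K0 V23 door `SIGMA-CLOSURE-K0-V23-Ax.g22.md`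
4ca252f7ab47910a, module #1 (the 21 letters V23's `…K0AllTorusOfStepTokensGuardedZBLam{,Print}` ∕ `…K0V23Defs` ∕ `…Stub3*Suppliers` consume, with their in-file dependencies).  Beneath: this
seat's `Record13LiveSelectorChi` (a) ∕ `Record13NumericsOfThm1CCMZChi` (b) ∕ `Record13NumericsOfThm1CCMWZBChi` (c).

WHY.  DEF-1's letters (`Record13LettersOfThm1CCMWZB`, A2ʷ-ZB) are stated over `gOfRecord₁₃ θ` ∕ `betaOfRecord₁₃ θ` at `θ := θ₁₅ᶜᶜᴹᵂᶻᴮ(j; γ; εbg)` — the running coupling and the β-functions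
of record read the β-slot cut-off CENTRED AT THE CHOICE `Ū^k(Classical.choose …)` (RC-1 «CHOICE CHANNEL», director-ym №462); the Summits-side Ax editions (dag-n07-w3, H3.3) need the same
letters over `gOfRecord₁₃Ax θᴬˣ` ∕ `betaOfRecord₁₃Ax θᴬˣ` ([Ax-3b] :600, [Ax-3a]) at the re-centred witness `θᴬˣ := theta13OfThm1CCMWZBAx …` (c), i.e. by a TOKEN MAP
`theta13OfThm1CCMWZB ↦ theta13OfThm1CCMWZBAx`, `gOfRecord₁₃ ↦ gOfRecord₁₃Ax`, `betaOfRecord₁₃ ↦ betaOfRecord₁₃Ax`, `<letter> ↦ <letter with CCMWZB ↦ CCMWZBAx>`.  This file supplies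
exactly those names, each a one-line instance of the χ-generic row `<letter>_chi` at `χ := chiFixed29Ax F N (numerics7OfThm1CCM F.L j ε₀ B₃ B₃' a₀ a₁) ε₂₉` (= `chiβOfRecord₁₃Ax θᴬˣ`, (c)'s
`chiβOfRecord₁₃Ax_theta13OfThm1CCMWZBAx`, `rfl`).

WHAT THIS FILE DECLARES (token for token against `Record13LettersOfThm1CCMWZB` :60–:377; its §7 kernel-sanity `example`s are not re-issued):
* §0⁺ FOUR θ-GENERIC χ ROWS (verbatim one-liners of their sources with `gOfRecord₁₃ θ ↦ gOfRecord₁₃Chi θ χ`, `betaOfRecord₁₃ θ ↦ betaOfRecord₁₃Chi θ χ`; `gOfRecord₁₃Chi θ χ p` IS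
  `genSeq (betaOfRecord₁₃Chi θ χ) p.g0`, [Ax-3b] :53): `Stage13Params.hmono_of_betaLowerH_chi` (13e `Record13MonotoneHistoryOfBetaSign` :45), `Stage13Params.hcompRev_of_betaBox_chi` (14d
  `Record13ReverseComparabilityOfBetaBox` :116), `Stage13Params.hcompBoth_of_betaBoxSignFree_chi` (`Record13SignFreeComparabilityOfBetaBox` :175), `Stage13Params.bg_numerics_of_letters_chi`
  (`Record13BgRow` :81).
* §0 ∕ §3 ∕ §4 ∕ §5 ∕ §6 ∕ §6′ IN THE χ SLOT (`…Chi` sections; 38 rows `<letter>_chi` + the face `lfOfRecord₁₂_theta13OfThm1CCMWZBChi`): (hnum), `εreg_le`, `hε0`, the window letters `hg`, `hpq`, `hα0`,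
  `mul_A0_nonneg ∕ mul_A0_le_C₀`, (hBα), (C1), (hcomp) from monotonicity, the gauge letters `gauge_mul_A0_nonneg ∕ _le_cB_C₀ ∕ _le_BCM_C₀ ∕ htI ∕ htMS`; the pins `τ9_M_pos ∕ M₁_pos ∕ hM ∕ hM₁ ∕
  collar_le_M₁{,'} ∕ hsN ∕ exists_wrap_…_of_le ∕ not_hsN_…_of_le ∕ hsN_…_iff` (window- AND centre-blind: verbatim over `…theta13OfThm1CCM`); the β transfer `betaOfRecord₁₃_…_eq_of_mem` to the
  half-window member and its four `BetaLowerH ∕ BetaUpperH` transports (χ-blind: `betaOfMerged_of_mem`); (hmono) ∕ (hcomp) ∕ (hcompRev) ∕ their `_half` editions; the sign-free pair and its `_half`.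
* §A THE SAME 39 NAMES AT THE RE-CENTRED WITNESS (`…Ax` sections), each `:= <row>_chi … (χ := chiFixed29Ax F N (numerics7OfThm1CCM …) ε₂₉) …`.

HONEST FRAMING.  Token-pass re-issue (one-line instantiations BY NAME of g-generic ∕ β-generic cores, `rfl` faces, the source's elementary arithmetic verbatim); NO closed value of `E_k`,
`log z_k` or χ pinned for anybody; nothing of Bałaban's asserted, ported or discharged; no proviso content proved; every history clause stays CONDITIONAL on its displayed β-box;
K0ᴬ stmt-QuantumFields-27238 ∕ K1ᴬ 27239 ∕ K3ᴬ 27247 OPEN (door supply only; K2ᴬ 27246 proved by name); COUNT 8∕28 · K 1∕4 of record UNMOVED; one finite 𝕋⁴ programme at fixed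
`ε = L^{-K}` — NOT continuum ∕ ℝ⁴ ∕ OS; the Yang–Mills mass gap (Clay) is NOT proved by any of this.  No `sorry`, no `axiom`, no `def`, no `instance`, no `notation`; standard axioms only.
-/

noncomputable section

open MeasureTheory
open scoped Matrix.Norms.L2Operator

namespace Literature.MathematicalPhysics.QuantumFieldTheory.Balaban1983to89.Node00

open T4Continuum B14.Eq218Concrete B15DeterminingSets B12RegularSpaces111 B14RegularSpaces234 FlowStep FlowStepRuns
open B15Claim189N0OfRecord (genSeq_le_succ_of_beta_nonneg betaAlongHistory_nonneg_of_betaLowerH)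

/-! ## §0⁺. The four θ-generic history rows that read `gOfRecord₁₃ θ` ∕ `betaOfRecord₁₃ θ`, χ-generic (`gOfRecord₁₃Chi θ χ p = genSeq (betaOfRecord₁₃Chi θ χ) p.g0`, `rfl`) -/

section GenericChi

variable {F : T4Family} {N : ℕ} [NeZero N]

/-- **13e χ-GENERIC: THE WINDOWED HISTORY OF EVERY RUN IS NON-DECREASING WHEN THE χ-GENERIC β-FUNCTIONS ARE BOUNDED BELOW BY `b ≥ 0` ON THE WINDOW BOX** — `Stage13Params.hmono_of_betaLowerH`
(`Record13MonotoneHistoryOfBetaSign` :45) with `betaOfRecord₁₃ θ ↦ betaOfRecord₁₃Chi θ χ`, `gOfRecord₁₃ θ ↦ gOfRecord₁₃Chi θ χ`; verbatim proof.  CONDITIONAL on `BetaLowerH`.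
[cite: Balaban1987RG1, (0.20) p.256, Thm 2 p.259, §1 p.264; Balaban1988Convergent, (2.6) p.255] -/
theorem Stage13Params.hmono_of_betaLowerH_chi (θ : Stage13Params F N) (χ : ChiSlot F N) {b : ℝ} (hb : 0 ≤ b) (hlow : BetaLowerH b θ.γ (betaOfRecord₁₃Chi F N θ χ)) :
    ∀ (p : B12.RunParams) (n : ℕ), n ≤ p.K → Step.InInterval θ.γ n (gOfRecord₁₃Chi F N θ χ p) → ∀ m, m < n →
      gOfRecord₁₃Chi F N θ χ p m ≤ gOfRecord₁₃Chi F N θ χ p (m + 1) :=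
  fun p _ _ hw m hm =>
    genSeq_le_succ_of_beta_nonneg (betaOfRecord₁₃Chi F N θ χ) p.g0 (hw m hm.le).1 (hw (m + 1) hm).1
      (betaAlongHistory_nonneg_of_betaLowerH hb hlow hw m hm)

/-- **14d χ-GENERIC: THE REVERSE COMPARABILITY CLAUSE ALONG EVERY WINDOWED RUN** from the two-sided β-box of the χ-generic β-functions (`0 ≤ b`, `β′·θ.γ² ≤ ¾`, `0 ≤ A₀`, `0 ≤ cR`, `θ.γ ≤ 1`) —
`Stage13Params.hcompRev_of_betaBox` (`Record13ReverseComparabilityOfBetaBox` :116), same substitution; verbatim proof.  CONDITIONAL on the displayed β-box.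
[cite: Balaban1988Convergent, (2.4) p.255, (2.6)–(2.8) pp.255–256; Balaban1987RG1, (0.20) p.256, Thm 2 p.259, §1 p.264] -/
theorem Stage13Params.hcompRev_of_betaBox_chi (θ : Stage13Params F N) (χ : ChiSlot F N) (hA : 0 ≤ θ.ν.A₀) (hγ1 : θ.γ ≤ 1) (hcR : 0 ≤ θ.s2.cR)
    {b β' : ℝ} (hb : 0 ≤ b) (hlow : BetaLowerH b θ.γ (betaOfRecord₁₃Chi F N θ χ)) (hup : BetaUpperH β' θ.γ (betaOfRecord₁₃Chi F N θ χ))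
    (hletter : β' * θ.γ ^ 2 ≤ 3 / 4) :
    ∀ (p : B12.RunParams) (n : ℕ), n ≤ p.K → Step.InInterval θ.γ n (gOfRecord₁₃Chi F N θ χ p) → ∀ m, m < n →
      θ.s2.cR * epsOfRecord θ.ν (gOfRecord₁₃Chi F N θ χ p) (m + 1) ≤ 2 * (θ.s2.cR * epsOfRecord θ.ν (gOfRecord₁₃Chi F N θ χ p) m) :=
  fun _ _ _ hw => hcompRev_mul_of_hcompRev θ.ν hcR (hcompRev_genSeq_of_betaBox θ.ν hA hw hγ1 hb hlow hup hletter)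

/-- **SIGN-FREE §3 χ-GENERIC: (hcomp) ∧ (hcompRev) ALONG EVERY WINDOWED RUN FROM THE SIGN-FREE β-BOX** of the χ-generic β-functions on `]0, θ.γ]` (`θ.γ ≤ ½`, `p₀ = 1`, `0 ≤ A₀`, `0 ≤ cR`;
`−bₗ·θ.γ² ≤ 3`, `β′·θ.γ² ≤ ¾`) — `Stage13Params.hcompBoth_of_betaBoxSignFree` (`Record13SignFreeComparabilityOfBetaBox` :175), same substitution; verbatim proof.  CONDITIONAL on the displayed box.
[cite: Balaban1988Convergent, (2.4) p.255, (2.6)–(2.8) pp.255–256; Balaban1987RG1, (0.20) p.256, §1 p.264] -/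
theorem Stage13Params.hcompBoth_of_betaBoxSignFree_chi (θ : Stage13Params F N) (χ : ChiSlot F N) (hA : 0 ≤ θ.ν.A₀) (hp : θ.ν.p₀ = 1) (hγ : θ.γ ≤ 1 / 2) (hcR : 0 ≤ θ.s2.cR)
    {bl β' : ℝ} (hlow : BetaLowerH bl θ.γ (betaOfRecord₁₃Chi F N θ χ)) (hup : BetaUpperH β' θ.γ (betaOfRecord₁₃Chi F N θ χ))
    (hl : -bl * θ.γ ^ 2 ≤ 3) (hu : β' * θ.γ ^ 2 ≤ 3 / 4) :
    (∀ (p : B12.RunParams) (n : ℕ), n ≤ p.K → Step.InInterval θ.γ n (gOfRecord₁₃Chi F N θ χ p) → ∀ m, m < n →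
      θ.s2.cR * epsOfRecord θ.ν (gOfRecord₁₃Chi F N θ χ p) m ≤ 2 * (θ.s2.cR * epsOfRecord θ.ν (gOfRecord₁₃Chi F N θ χ p) (m + 1))) ∧
    (∀ (p : B12.RunParams) (n : ℕ), n ≤ p.K → Step.InInterval θ.γ n (gOfRecord₁₃Chi F N θ χ p) → ∀ m, m < n →
      θ.s2.cR * epsOfRecord θ.ν (gOfRecord₁₃Chi F N θ χ p) (m + 1) ≤ 2 * (θ.s2.cR * epsOfRecord θ.ν (gOfRecord₁₃Chi F N θ χ p) m)) :=
  ⟨fun _ _ _ hw => hcomp_mul_of_hcomp θ.ν hcR (hcompBoth_genSeq_of_betaBoxSignFree θ.ν hp hA hw hγ hlow hup hl hu).1,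
    fun _ _ _ hw => hcompRev_mul_of_hcompRev θ.ν hcR (hcompBoth_genSeq_of_betaBoxSignFree θ.ν hp hA hw hγ hlow hup hl hu).2⟩

/-- **`bg_numerics_of_letters` χ-GENERIC: THE THIRD NUMERICS CLAUSE FROM THE LETTERS** along a run whose χ-generic history satisfies `0 < g_m`, `g_m² ≤ e⁻¹` up to level `n` (`p₀ ≤ q₀`,
`0 ≤ B₃·cR·A₀ ≤ (1 − β)·C₀`) — `Stage13Params.bg_numerics_of_letters` (`Record13BgRow` :81) with `gOfRecord₁₃ θ ↦ gOfRecord₁₃Chi θ χ`; verbatim proof (`hBα_of_numerics`, g-generic).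
[cite: Balaban1988Convergent, (2.4) p.255, (2.28) p.259, (2.34) p.261] -/
theorem Stage13Params.bg_numerics_of_letters_chi (θ : Stage13Params F N) (χ : ChiSlot F N) {B₃ : ℝ} (hpq : θ.ν.p₀ ≤ (lfOfRecord₁₂ F N θ.toStage12Params).q₀)
    (hBc : 0 ≤ B₃ * θ.s2.cR * θ.ν.A₀) (hC : B₃ * θ.s2.cR * θ.ν.A₀ ≤ (1 - θ.s2.βc) * (lfOfRecord₁₂ F N θ.toStage12Params).C₀)
    (p : B12.RunParams) (n : ℕ) (hw : ∀ m, m ≤ n → 0 < gOfRecord₁₃Chi F N θ χ p m ∧ gOfRecord₁₃Chi F N θ χ p m ^ 2 ≤ Real.exp (-1)) :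
    ∀ m, 1 ≤ m → m ≤ n →
      B₃ * (θ.s2.cR * epsOfRecord θ.ν (gOfRecord₁₃Chi F N θ χ p) m) ≤ (1 - θ.s2.βc) * (lfOfRecord₁₂ F N θ.toStage12Params).alpha0 (gOfRecord₁₃Chi F N θ χ p m) :=
  hBα_of_numerics (lfOfRecord₁₂ F N θ.toStage12Params) θ.ν hw hpq hBc hC

end GenericChi

/-! # PART χ — the letters at `θ₁₅ᶜᶜᴹᵂᶻᴮ(j; γ; εbg)[χ] := theta13OfThm1CCMWZBChi … χ` (`Record13LettersOfThm1CCMWZB` §0–§6′ under the σ-recipe; section titles kept) -/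

/-! ## §0. The one window-blind face of `θ₁₅ᶜᶜᴹᵂᶻᴮ(j; γ; εbg)` A2ʷ's proofs read that Z3 does not already print: the large-field letters (`rfl`). The numerics faces
`theta13OfThm1CCMWZBChi_εreg ∕ _A₀ ∕ _p₀ ∕ _r ∕ _M₁ ∕ _cB ∕ _B ∕ _C ∕ _Mr ∕ _cR ∕ _βc ∕ _τ9_M ∕ _γ` are Z3's (`Record13NumericsOfThm1CCMWZBChi` §1), cited by name below. -/

section FacesZChi

variable (F : T4Family) (N : ℕ) [NeZero N] (j : ℕ) (γ εbg ε₀ ε₂₉ B₃ B₃' a₀ a₁ : ℝ) (Efl logz : B12.RunParams → ℕ → ℝ) (χ : ChiSlot F N)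

/-- The large-field letters of record at `θ₁₅ᶜᶜᴹᵂᶻᴮ(j; γ; εbg)`: the family's constants with the window `γ` (`rfl`; A1ʷ's `lfOfRecord₁₂_theta13OfThm1CCMW`, token-pass). [cite: Balaban1988Convergent, (2.28) p.259 (bookkeeping)] -/
theorem lfOfRecord₁₂_theta13OfThm1CCMWZBChi :
    lfOfRecord₁₂ F N (theta13OfThm1CCMWZBChi F N j γ εbg ε₀ ε₂₉ B₃ B₃' a₀ a₁ Efl logz χ).toStage12Params = { lfConstsOfFamily with γ := γ } := rfl

end FacesZChi

/-! ## §3. The letters of the GAUGE road at `θ₁₅ᶜᶜᴹᵂᶻᴮ(j; γ; εbg)`, along every `γ`-windowed run, `γ ≤ ½` -/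

section FacesChi

variable {F : T4Family} {N : ℕ} [NeZero N] {j : ℕ} {γ εbg ε₀ ε₂₉ B₃ B₃' a₀ a₁ : ℝ} {Efl logz : B12.RunParams → ℕ → ℝ} {χ : ChiSlot F N}

/-- **(hnum) AT `θ₁₅ᶜᶜᴹᵂᶻᴮ(j; γ; εbg)`** (`γ ≤ ½ < 1`): `0 < cR·ε_m ≤ a₁`, `B₃·cR·ε_m ≤ εreg = a₀` along every windowed run (13a's window lemma; thresholds window-blind).
[cite: Balaban1988Convergent, (2.4) p.255, (2.12) p.256; Balaban1985Variational, Thm 1 (7)–(8) p.279] -/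
theorem hnum_theta13OfThm1CCMWZB_chi (hγ : γ ≤ 1 / 2) (hB : 0 ≤ B₃) (hB' : 0 ≤ B₃') (ha₀ : 0 < a₀) (ha₁ : 0 < a₁) :
     ∀ (p : B12.RunParams) (n : ℕ), n ≤ p.K → Step.InInterval (theta13OfThm1CCMWZBChi F N j γ εbg ε₀ ε₂₉ B₃ B₃' a₀ a₁ Efl logz χ).γ n (gOfRecord₁₃Chi F N (theta13OfThm1CCMWZBChi F N j γ εbg ε₀ ε₂₉ B₃ B₃' a₀ a₁ Efl logz χ) χ p) → ∀ m, m ≤ n →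
      0 < (theta13OfThm1CCMWZBChi F N j γ εbg ε₀ ε₂₉ B₃ B₃' a₀ a₁ Efl logz χ).s2.cR * epsOfRecord (theta13OfThm1CCMWZBChi F N j γ εbg ε₀ ε₂₉ B₃ B₃' a₀ a₁ Efl logz χ).ν (gOfRecord₁₃Chi F N (theta13OfThm1CCMWZBChi F N j γ εbg ε₀ ε₂₉ B₃ B₃' a₀ a₁ Efl logz χ) χ p) m ∧ (theta13OfThm1CCMWZBChi F N j γ εbg ε₀ ε₂₉ B₃ B₃' a₀ a₁ Efl logz χ).s2.cR * epsOfRecord (theta13OfThm1CCMWZBChi F N j γ εbg ε₀ ε₂₉ B₃ B₃' a₀ a₁ Efl logz χ).ν (gOfRecord₁₃Chi F N (theta13OfThm1CCMWZBChi F N j γ εbg ε₀ ε₂₉ B₃ B₃' a₀ a₁ Efl logz χ) χ p) m ≤ a₁ ∧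
        B₃ * ((theta13OfThm1CCMWZBChi F N j γ εbg ε₀ ε₂₉ B₃ B₃' a₀ a₁ Efl logz χ).s2.cR * epsOfRecord (theta13OfThm1CCMWZBChi F N j γ εbg ε₀ ε₂₉ B₃ B₃' a₀ a₁ Efl logz χ).ν (gOfRecord₁₃Chi F N (theta13OfThm1CCMWZBChi F N j γ εbg ε₀ ε₂₉ B₃ B₃' a₀ a₁ Efl logz χ) χ p) m) ≤ (theta13OfThm1CCMWZBChi F N j γ εbg ε₀ ε₂₉ B₃ B₃' a₀ a₁ Efl logz χ).ν.εreg :=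
  fun _ _ _ hw => numerics_thm1CC1_of_inInterval (L := F.L) (ε₀ := ε₀) hB hB' ha₀ ha₁ (hγ.trans_lt (by norm_num) : γ < 1) hw

/-- `θ₁₅ᶜᶜᴹᵂᶻᴮ(j; γ; εbg).ν.εreg ≤ a₀` (it IS `a₀`). [cite: Balaban1985Variational, Thm 1 (8) p.279 (bookkeeping)] -/
theorem εreg_le_theta13OfThm1CCMWZB_chi : (theta13OfThm1CCMWZBChi F N j γ εbg ε₀ ε₂₉ B₃ B₃' a₀ a₁ Efl logz χ).ν.εreg ≤ a₀ := (theta13OfThm1CCMWZBChi_εreg F N j γ εbg ε₀ ε₂₉ B₃ B₃' a₀ a₁ Efl logz χ).le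

/-- **`0 ≤ cR·ε_m` AT `θ₁₅ᶜᶜᴹᵂᶻᴮ(j; γ; εbg)`** along every windowed run. [cite: Balaban1988Convergent, (2.4) p.255, (2.10) p.256 (bookkeeping)] -/
theorem hε0_theta13OfThm1CCMWZB_chi (hγ : γ ≤ 1 / 2) (hB : 0 ≤ B₃) (hB' : 0 ≤ B₃') (ha₀ : 0 < a₀) (ha₁ : 0 < a₁) :
     ∀ (p : B12.RunParams) (n : ℕ), n ≤ p.K → Step.InInterval (theta13OfThm1CCMWZBChi F N j γ εbg ε₀ ε₂₉ B₃ B₃' a₀ a₁ Efl logz χ).γ n (gOfRecord₁₃Chi F N (theta13OfThm1CCMWZBChi F N j γ εbg ε₀ ε₂₉ B₃ B₃' a₀ a₁ Efl logz χ) χ p) → ∀ m, m ≤ n → 0 ≤ (theta13OfThm1CCMWZBChi F N j γ εbg ε₀ ε₂₉ B₃ B₃' a₀ a₁ Efl logz χ).s2.cR * epsOfRecord (theta13OfThm1CCMWZBChi F N j γ εbg ε₀ ε₂₉ B₃ B₃' a₀ a₁ Efl logz χ).ν (gOfRecord₁₃Chi F N (theta13OfThm1CCMWZBChi F N j γ εbg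 ε₀ ε₂₉ B₃ B₃' a₀ a₁ Efl logz χ) χ p) m :=
  fun p n hn hw m hm => (hnum_theta13OfThm1CCMWZB_chi hγ hB hB' ha₀ ha₁ p n hn hw m hm).1.le

/-- **THE WINDOW LETTERS AT `θ₁₅ᶜᶜᴹᵂᶻᴮ(j; γ; εbg)`** (`γ ≤ ½`): `0 < g_m`, `g_m² ≤ e⁻¹` along every windowed run. [cite: Balaban1987RG1, Thm 1 p.259; Balaban1988Convergent, (2.4) p.255 (bookkeeping)] -/
theorem hg_theta13OfThm1CCMWZB_chi (hγ : γ ≤ 1 / 2) :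
     ∀ (p : B12.RunParams) (n : ℕ), n ≤ p.K → Step.InInterval (theta13OfThm1CCMWZBChi F N j γ εbg ε₀ ε₂₉ B₃ B₃' a₀ a₁ Efl logz χ).γ n (gOfRecord₁₃Chi F N (theta13OfThm1CCMWZBChi F N j γ εbg ε₀ ε₂₉ B₃ B₃' a₀ a₁ Efl logz χ) χ p) → ∀ m, m ≤ n → 0 < gOfRecord₁₃Chi F N (theta13OfThm1CCMWZBChi F N j γ εbg ε₀ ε₂₉ B₃ B₃' a₀ a₁ Efl logz χ) χ p m ∧ gOfRecord₁₃Chi F N (theta13OfThm1CCMWZBChi F N j γ εbg ε₀ ε₂₉ B₃ B₃' a₀ a₁ Efl logz χ) χ p m ^ 2 ≤ Real.exp (-1) :=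
  fun _ _ _ hw => window_sq_le_of_inInterval ((theta13OfThm1CCMWZBChi_γ F N j γ εbg ε₀ ε₂₉ B₃ B₃' a₀ a₁ Efl logz χ).trans_le hγ) hw

/-- **`p₀ ≤ q₀` AT `θ₁₅ᶜᶜᴹᵂᶻᴮ(j; γ; εbg)`** (`1 ≤ 2`). [cite: Balaban1988Convergent, (2.4) p.255, (2.28) p.259 (bookkeeping)] -/
theorem hpq_theta13OfThm1CCMWZB_chi : (theta13OfThm1CCMWZBChi F N j γ εbg ε₀ ε₂₉ B₃ B₃' a₀ a₁ Efl logz χ).ν.p₀ ≤ (lfOfRecord₁₂ F N (theta13OfThm1CCMWZBChi F N j γ εbg ε₀ ε₂₉ B₃ B₃' a₀ a₁ Efl logz χ).toStage12Params).q₀ := by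
  rw [theta13OfThm1CCMWZBChi_p₀, lfOfRecord₁₂_theta13OfThm1CCMWZBChi]; norm_num [lfConstsOfFamily, lfConstsOfRecord₁₂]

/-- **`α₀(g_m) > 0` AT `θ₁₅ᶜᶜᴹᵂᶻᴮ(j; γ; εbg)`** along every windowed run (`C₀ = 1 > 0`, `0 < g_m ≤ γ ≤ ½ < 1`). [cite: Balaban1988Convergent, (2.28) p.259 (bookkeeping)] -/
theorem hα0_theta13OfThm1CCMWZB_chi (hγ : γ ≤ 1 / 2) :
    ∀ (p : B12.RunParams) (n : ℕ), n ≤ p.K → Step.InInterval (theta13OfThm1CCMWZBChi F N j γ εbg ε₀ ε₂₉ B₃ B₃' a₀ a₁ Efl logz χ).γ n (gOfRecord₁₃Chi F N (theta13OfThm1CCMWZBChi F N j γ εbg ε₀ ε₂₉ B₃ B₃' a₀ a₁ Efl logz χ) χ p) → ∀ m, m ≤ n →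
      0 < (lfOfRecord₁₂ F N (theta13OfThm1CCMWZBChi F N j γ εbg ε₀ ε₂₉ B₃ B₃' a₀ a₁ Efl logz χ).toStage12Params).alpha0 (gOfRecord₁₃Chi F N (theta13OfThm1CCMWZBChi F N j γ εbg ε₀ ε₂₉ B₃ B₃' a₀ a₁ Efl logz χ) χ p m) :=
  fun p n _ hw m hm => alpha0_pos_of_lt_one _ (by rw [lfOfRecord₁₂_theta13OfThm1CCMWZBChi]; norm_num [lfConstsOfFamily, lfConstsOfRecord₁₂]) (hw m hm).1
    ((hw m hm).2.trans_lt ((theta13OfThm1CCMWZBChi_γ F N j γ εbg ε₀ ε₂₉ B₃ B₃' a₀ a₁ Efl logz χ).trans_lt (hγ.trans_lt (by norm_num))))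

/-- `0 ≤ B₃·cR·A₀` at `θ₁₅ᶜᶜᴹᵂᶻᴮ(j; γ; εbg)` (window-blind: A2's at `θ₁₅ᶜᶜᴹ(j)`). [cite: Balaban1988Convergent, (2.28) p.259 (bookkeeping)] -/
theorem mul_A0_nonneg_thm1CCMWZB_chi (hB : 0 ≤ B₃) (hB' : 0 ≤ B₃') (ha₀ : 0 ≤ a₀) (ha₁ : 0 ≤ a₁) :
    0 ≤ B₃ * (theta13OfThm1CCMWZBChi F N j γ εbg ε₀ ε₂₉ B₃ B₃' a₀ a₁ Efl logz χ).s2.cR * (theta13OfThm1CCMWZBChi F N j γ εbg ε₀ ε₂₉ B₃ B₃' a₀ a₁ Efl logz χ).ν.A₀ :=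
  mul_A0_nonneg_thm1CCM (F := F) (N := N) (j := j) (ε₀ := ε₀) (ε₂₉ := ε₂₉) hB hB' ha₀ ha₁

/-- The «C₀ sufficiently large» inequality of (2.34) at `θ₁₅ᶜᶜᴹᵂᶻᴮ(j; γ; εbg)`: `B₃·cR·A₀ᶜᶜ¹ ≤ (1 − β)·C₀` (window-blind). [cite: Balaban1988Convergent, (2.28) p.259, (2.34) p.261] -/
theorem mul_A0_le_C₀_thm1CCMWZB_chi (hB : 0 ≤ B₃) (hB' : 0 ≤ B₃') (ha₀ : 0 ≤ a₀) (ha₁ : 0 ≤ a₁) :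
    B₃ * (theta13OfThm1CCMWZBChi F N j γ εbg ε₀ ε₂₉ B₃ B₃' a₀ a₁ Efl logz χ).s2.cR * (theta13OfThm1CCMWZBChi F N j γ εbg ε₀ ε₂₉ B₃ B₃' a₀ a₁ Efl logz χ).ν.A₀ ≤
      (1 - (theta13OfThm1CCMWZBChi F N j γ εbg ε₀ ε₂₉ B₃ B₃' a₀ a₁ Efl logz χ).s2.βc) * (lfOfRecord₁₂ F N (theta13OfThm1CCMWZBChi F N j γ εbg ε₀ ε₂₉ B₃ B₃' a₀ a₁ Efl logz χ).toStage12Params).C₀ := by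
  rw [theta13OfThm1CCMWZBChi_cR, mul_one, theta13OfThm1CCMWZBChi_A₀, theta13OfThm1CCMWZBChi_βc, lfOfRecord₁₂_theta13OfThm1CCMWZBChi]
  have h := mul_A0OfThm1CC1_le (L := F.L) hB hB' ha₀ ha₁
  norm_num [lfConstsOfFamily, lfConstsOfRecord₁₂]
  linarith

/-- **(hBα) AT `θ₁₅ᶜᶜᴹᵂᶻᴮ(j; γ; εbg)`** (`bg_numerics_of_letters`: `p₀ = 1 ≤ q₀ = 2`, `B₃·A₀ᶜᶜ¹ ≤ ¾·C₀`, `g_m² ≤ e⁻¹`). [cite: Balaban1988Convergent, (2.4) p.255, (2.28) p.259, (2.34) p.261] -/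
theorem hBα_theta13OfThm1CCMWZB_chi (hγ : γ ≤ 1 / 2) (hB : 0 ≤ B₃) (hB' : 0 ≤ B₃') (ha₀ : 0 ≤ a₀) (ha₁ : 0 ≤ a₁) :
     ∀ (p : B12.RunParams) (n : ℕ), n ≤ p.K → Step.InInterval (theta13OfThm1CCMWZBChi F N j γ εbg ε₀ ε₂₉ B₃ B₃' a₀ a₁ Efl logz χ).γ n (gOfRecord₁₃Chi F N (theta13OfThm1CCMWZBChi F N j γ εbg ε₀ ε₂₉ B₃ B₃' a₀ a₁ Efl logz χ) χ p) → ∀ m, 1 ≤ m → m ≤ n →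
      B₃ * ((theta13OfThm1CCMWZBChi F N j γ εbg ε₀ ε₂₉ B₃ B₃' a₀ a₁ Efl logz χ).s2.cR * epsOfRecord (theta13OfThm1CCMWZBChi F N j γ εbg ε₀ ε₂₉ B₃ B₃' a₀ a₁ Efl logz χ).ν (gOfRecord₁₃Chi F N (theta13OfThm1CCMWZBChi F N j γ εbg ε₀ ε₂₉ B₃ B₃' a₀ a₁ Efl logz χ) χ p) m) ≤ (1 - (theta13OfThm1CCMWZBChi F N j γ εbg ε₀ ε₂₉ B₃ B₃' a₀ a₁ Efl logz χ).s2.βc) * (lfOfRecord₁₂ F N (theta13OfThm1CCMWZBChi F N j γ εbg ε₀ ε₂₉ B₃ B₃' a₀ a₁ Efl logz χ).toStage12Params).alpha0 (gOfRecord₁₃Chi F N (theta13OfThm1CCMWZBChi F N j γ εbg ε₀ ε₂₉ B₃ B₃' a₀ a₁ Efl logz χ) χ p m) :=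
  fun p n _ hw =>
    (theta13OfThm1CCMWZBChi F N j γ εbg ε₀ ε₂₉ B₃ B₃' a₀ a₁ Efl logz χ).bg_numerics_of_letters_chi χ hpq_theta13OfThm1CCMWZB_chi
      (mul_A0_nonneg_thm1CCMWZB_chi hB hB' ha₀ ha₁) (mul_A0_le_C₀_thm1CCMWZB_chi hB hB' ha₀ ha₁) p n (hg_theta13OfThm1CCMWZB_chi hγ p n ‹_› hw)

/-- **(C1) NESTED GRIDS AT `θ₁₅ᶜᶜᴹᵂᶻᴮ(j; γ; εbg)`**: `R_m = L·t_m` along every windowed run (`L ≥ 2`, `r = 1`, `log g_m⁻² > 1` in `]0, γ] ⊆ ]0, ½]`). [cite: Balaban1988Convergent, (2.5) p.255, p.257] -/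
theorem hC1_theta13OfThm1CCMWZB_chi (hγ : γ ≤ 1 / 2) :
     ∀ (p : B12.RunParams) (n : ℕ), n ≤ p.K → Step.InInterval (theta13OfThm1CCMWZBChi F N j γ εbg ε₀ ε₂₉ B₃ B₃' a₀ a₁ Efl logz χ).γ n (gOfRecord₁₃Chi F N (theta13OfThm1CCMWZBChi F N j γ εbg ε₀ ε₂₉ B₃ B₃' a₀ a₁ Efl logz χ) χ p) → ∀ m, 1 ≤ m → m ≤ n →
      ∃ t : ℕ, 0 < t ∧ RkOfRecord (F.P p.K).L (theta13OfThm1CCMWZBChi F N j γ εbg ε₀ ε₂₉ B₃ B₃' a₀ a₁ Efl logz χ).ν.r (gOfRecord₁₃Chi F N (theta13OfThm1CCMWZBChi F N j γ εbg ε₀ ε₂₉ B₃ B₃' a₀ a₁ Efl logz χ) χ p m) = (F.P p.K).L * t := by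
  intro p n _ hw m _ hm
  have hL : 2 ≤ (F.P p.K).L := by show 2 ≤ F.L; have := F.hL11; omega
  exact exists_RkOfRecord_eq_mul hL (le_of_eq (theta13OfThm1CCMWZBChi_r F N j γ εbg ε₀ ε₂₉ B₃ B₃' a₀ a₁ Efl logz χ).symm)
    (one_lt_log_inv_sq_of_le_half (hw m hm).1 ((hw m hm).2.trans ((theta13OfThm1CCMWZBChi_γ F N j γ εbg ε₀ ε₂₉ B₃ B₃' a₀ a₁ Efl logz χ).trans_le hγ)))

/-- **(hcomp) AT `θ₁₅ᶜᶜᴹᵂᶻᴮ(j; γ; εbg)` from the MONOTONICITY of the windowed history** (`cR·ε_m ≤ 2·cR·ε_{m+1}`; `p₀ = 1`, `A₀ ≥ 0`, `g_{m+1} ≤ γ ≤ ½`).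
[cite: Balaban1988Convergent, (2.4) p.255, (2.7)–(2.8) pp.255–256; Balaban1987RG1, Thm 1 p.259] -/
theorem hcomp_theta13OfThm1CCMWZB_of_monotone_chi (hγ : γ ≤ 1 / 2) (hB : 0 ≤ B₃) (hB' : 0 ≤ B₃') (ha₀ : 0 ≤ a₀) (ha₁ : 0 ≤ a₁)
    (hmono : ∀ (p : B12.RunParams) (n : ℕ), n ≤ p.K → Step.InInterval (theta13OfThm1CCMWZBChi F N j γ εbg ε₀ ε₂₉ B₃ B₃' a₀ a₁ Efl logz χ).γ n (gOfRecord₁₃Chi F N (theta13OfThm1CCMWZBChi F N j γ εbg ε₀ ε₂₉ B₃ B₃' a₀ a₁ Efl logz χ) χ p) → ∀ m, m < n →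
      gOfRecord₁₃Chi F N (theta13OfThm1CCMWZBChi F N j γ εbg ε₀ ε₂₉ B₃ B₃' a₀ a₁ Efl logz χ) χ p m ≤ gOfRecord₁₃Chi F N (theta13OfThm1CCMWZBChi F N j γ εbg ε₀ ε₂₉ B₃ B₃' a₀ a₁ Efl logz χ) χ p (m + 1)) :
     ∀ (p : B12.RunParams) (n : ℕ), n ≤ p.K → Step.InInterval (theta13OfThm1CCMWZBChi F N j γ εbg ε₀ ε₂₉ B₃ B₃' a₀ a₁ Efl logz χ).γ n (gOfRecord₁₃Chi F N (theta13OfThm1CCMWZBChi F N j γ εbg ε₀ ε₂₉ B₃ B₃' a₀ a₁ Efl logz χ) χ p) → ∀ m, m < n →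
      (theta13OfThm1CCMWZBChi F N j γ εbg ε₀ ε₂₉ B₃ B₃' a₀ a₁ Efl logz χ).s2.cR * epsOfRecord (theta13OfThm1CCMWZBChi F N j γ εbg ε₀ ε₂₉ B₃ B₃' a₀ a₁ Efl logz χ).ν (gOfRecord₁₃Chi F N (theta13OfThm1CCMWZBChi F N j γ εbg ε₀ ε₂₉ B₃ B₃' a₀ a₁ Efl logz χ) χ p) m ≤ 2 * ((theta13OfThm1CCMWZBChi F N j γ εbg ε₀ ε₂₉ B₃ B₃' a₀ a₁ Efl logz χ).s2.cR * epsOfRecord (theta13OfThm1CCMWZBChi F N j γ εbg ε₀ ε₂₉ B₃ B₃' a₀ a₁ Efl logz χ).ν (gOfRecord₁₃Chi F N (theta13OfThm1CCMWZBChi F N j γ εbg ε₀ ε₂₉ B₃ B₃' a₀ a₁ Efl logz χ) χ p) (m + 1)) := by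
  intro p n hn hw m hm
  rw [theta13OfThm1CCMWZBChi_cR, one_mul, one_mul]
  have hγ' := theta13OfThm1CCMWZBChi_γ F N j γ εbg ε₀ ε₂₉ B₃ B₃' a₀ a₁ Efl logz χ
  have h0 : 0 < gOfRecord₁₃Chi F N (theta13OfThm1CCMWZBChi F N j γ εbg ε₀ ε₂₉ B₃ B₃' a₀ a₁ Efl logz χ) χ p m := (hw m hm.le).1
  have hhalf : gOfRecord₁₃Chi F N (theta13OfThm1CCMWZBChi F N j γ εbg ε₀ ε₂₉ B₃ B₃' a₀ a₁ Efl logz χ) χ p (m + 1) ≤ 1 / 2 := ((hw (m + 1) hm).2.trans hγ'.le).trans hγ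
  exact epsOfRecord_le_two_mul_of_le _ (theta13OfThm1CCMWZBChi_p₀ F N j γ εbg ε₀ ε₂₉ B₃ B₃' a₀ a₁ Efl logz χ)
    (by rw [theta13OfThm1CCMWZBChi_A₀]; exact A0OfThm1CC1_nonneg hB hB' ha₀ ha₁) h0 (hmono p n hn hw m hm) hhalf

/-- `0 ≤ B₃′·cR·A₀` at `θ₁₅ᶜᶜᴹᵂᶻᴮ(j; γ; εbg)` (window-blind). [cite: Balaban1988Convergent, (2.28) p.259 (bookkeeping)] -/
theorem gauge_mul_A0_nonneg_thm1CCMWZB_chi (hB : 0 ≤ B₃) (hB' : 0 ≤ B₃') (ha₀ : 0 ≤ a₀) (ha₁ : 0 ≤ a₁) :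
    0 ≤ B₃' * (theta13OfThm1CCMWZBChi F N j γ εbg ε₀ ε₂₉ B₃ B₃' a₀ a₁ Efl logz χ).s2.cR * (theta13OfThm1CCMWZBChi F N j γ εbg ε₀ ε₂₉ B₃ B₃' a₀ a₁ Efl logz χ).ν.A₀ :=
  gauge_mul_A0_nonneg_thm1CCM (F := F) (N := N) (j := j) (ε₀ := ε₀) (ε₂₉ := ε₂₉) hB hB' ha₀ ha₁

/-- **«C₀ sufficiently large» FOR THE I-FAMILY GAUGES at `θ₁₅ᶜᶜᴹᵂᶻᴮ(j; γ; εbg)`**: `B₃′·cR·A₀ ≤ cB·C₀` (window-blind). [cite: Balaban1987RG1, (1.12) p.262; Balaban1988Convergent, (2.28) p.259] -/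
theorem gauge_mul_A0_le_cB_C₀_thm1CCMWZB_chi (hB : 0 ≤ B₃) (hB' : 0 ≤ B₃') (ha₀ : 0 ≤ a₀) (ha₁ : 0 ≤ a₁) :
    B₃' * (theta13OfThm1CCMWZBChi F N j γ εbg ε₀ ε₂₉ B₃ B₃' a₀ a₁ Efl logz χ).s2.cR * (theta13OfThm1CCMWZBChi F N j γ εbg ε₀ ε₂₉ B₃ B₃' a₀ a₁ Efl logz χ).ν.A₀ ≤ (theta13OfThm1CCMWZBChi F N j γ εbg ε₀ ε₂₉ B₃ B₃' a₀ a₁ Efl logz χ).s2.cB * (lfOfRecord₁₂ F N (theta13OfThm1CCMWZBChi F N j γ εbg ε₀ ε₂₉ B₃ B₃' a₀ a₁ Efl logz χ).toStage12Params).C₀ := by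
  rw [theta13OfThm1CCMWZBChi_cR, mul_one, theta13OfThm1CCMWZBChi_A₀, theta13OfThm1CCMWZBChi_cB, lfOfRecord₁₂_theta13OfThm1CCMWZBChi]
  have h1 : (1 : ℝ) ≤ F.L := by exact_mod_cast F.hL.2.le
  have h := gauge_mul_A0OfThm1CC1_le (L := F.L) F.hL.2.le hB hB' ha₀ ha₁
  norm_num [lfConstsOfFamily, lfConstsOfRecord₁₂]
  nlinarith

/-- **«C₀ sufficiently large» FOR THE MS-FAMILY GAUGES at `θ₁₅ᶜᶜᴹᵂᶻᴮ(j; γ; εbg)`**: `B₃′·cR·A₀ ≤ B·C·M_r·C₀` (window-blind). [cite: Balaban1988Convergent, (2.38) p.261, (2.28) p.259] -/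
theorem gauge_mul_A0_le_BCM_C₀_thm1CCMWZB_chi (hB : 0 ≤ B₃) (hB' : 0 ≤ B₃') (ha₀ : 0 ≤ a₀) (ha₁ : 0 ≤ a₁) :
    B₃' * (theta13OfThm1CCMWZBChi F N j γ εbg ε₀ ε₂₉ B₃ B₃' a₀ a₁ Efl logz χ).s2.cR * (theta13OfThm1CCMWZBChi F N j γ εbg ε₀ ε₂₉ B₃ B₃' a₀ a₁ Efl logz χ).ν.A₀ ≤ (theta13OfThm1CCMWZBChi F N j γ εbg ε₀ ε₂₉ B₃ B₃' a₀ a₁ Efl logz χ).s2.B * (theta13OfThm1CCMWZBChi F N j γ εbg ε₀ ε₂₉ B₃ B₃' a₀ a₁ Efl logz χ).s2.C * (theta13OfThm1CCMWZBChi F N j γ εbg ε₀ ε₂₉ B₃ B₃' a₀ a₁ Efl logz χ).s2.Mr * (lfOfRecord₁₂ F N (theta13OfThm1CCMWZBChi F N j γ εbg ε₀ ε₂₉ B₃ B₃' a₀ a₁ Efl logz χ).toStage12Params).C₀ := by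
  rw [theta13OfThm1CCMWZBChi_cR, mul_one, theta13OfThm1CCMWZBChi_A₀, theta13OfThm1CCMWZBChi_B, theta13OfThm1CCMWZBChi_C, theta13OfThm1CCMWZBChi_Mr, lfOfRecord₁₂_theta13OfThm1CCMWZBChi]
  have h := gauge_mul_A0OfThm1CC1_le (L := F.L) F.hL.2.le hB hB' ha₀ ha₁
  norm_num [lfConstsOfFamily, lfConstsOfRecord₁₂]
  linarith

/-- **★ THE I-FAMILY RADIUS LETTER `htI` ALONG EVERY WINDOWED RUN AT `θ₁₅ᶜᶜᴹᵂᶻᴮ(j; γ; εbg)`**: `B₃′·(cR·ε_m) ≤ cB·α₀(g_m)`, `1 ≤ m ≤ n` (FILE 14 `gaugeLetter_of_numerics`).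
[cite: Balaban1987RG1, (1.12) p.262; Balaban1988Convergent, (2.4) p.255, (2.28) p.259] -/
theorem htI_theta13OfThm1CCMWZB_chi (hγ : γ ≤ 1 / 2) (hB : 0 ≤ B₃) (hB' : 0 ≤ B₃') (ha₀ : 0 ≤ a₀) (ha₁ : 0 ≤ a₁) :
    ∀ (p : B12.RunParams) (n : ℕ), n ≤ p.K → Step.InInterval (theta13OfThm1CCMWZBChi F N j γ εbg ε₀ ε₂₉ B₃ B₃' a₀ a₁ Efl logz χ).γ n (gOfRecord₁₃Chi F N (theta13OfThm1CCMWZBChi F N j γ εbg ε₀ ε₂₉ B₃ B₃' a₀ a₁ Efl logz χ) χ p) → ∀ m, 1 ≤ m → m ≤ n →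
      B₃' * ((theta13OfThm1CCMWZBChi F N j γ εbg ε₀ ε₂₉ B₃ B₃' a₀ a₁ Efl logz χ).s2.cR * epsOfRecord (theta13OfThm1CCMWZBChi F N j γ εbg ε₀ ε₂₉ B₃ B₃' a₀ a₁ Efl logz χ).ν (gOfRecord₁₃Chi F N (theta13OfThm1CCMWZBChi F N j γ εbg ε₀ ε₂₉ B₃ B₃' a₀ a₁ Efl logz χ) χ p) m) ≤
        (theta13OfThm1CCMWZBChi F N j γ εbg ε₀ ε₂₉ B₃ B₃' a₀ a₁ Efl logz χ).s2.cB * (lfOfRecord₁₂ F N (theta13OfThm1CCMWZBChi F N j γ εbg ε₀ ε₂₉ B₃ B₃' a₀ a₁ Efl logz χ).toStage12Params).alpha0 (gOfRecord₁₃Chi F N (theta13OfThm1CCMWZBChi F N j γ εbg ε₀ ε₂₉ B₃ B₃' a₀ a₁ Efl logz χ) χ p m) :=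
  fun p n hn hw => gaugeLetter_of_numerics (lfOfRecord₁₂ F N (theta13OfThm1CCMWZBChi F N j γ εbg ε₀ ε₂₉ B₃ B₃' a₀ a₁ Efl logz χ).toStage12Params) (theta13OfThm1CCMWZBChi F N j γ εbg ε₀ ε₂₉ B₃ B₃' a₀ a₁ Efl logz χ).ν
    (fun m _ hm => hg_theta13OfThm1CCMWZB_chi hγ p n hn hw m hm) hpq_theta13OfThm1CCMWZB_chi (gauge_mul_A0_nonneg_thm1CCMWZB_chi hB hB' ha₀ ha₁) (gauge_mul_A0_le_cB_C₀_thm1CCMWZB_chi hB hB' ha₀ ha₁)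

/-- **★ THE MS-FAMILY RADIUS LETTER `htMS` ALONG EVERY WINDOWED RUN AT `θ₁₅ᶜᶜᴹᵂᶻᴮ(j; γ; εbg)`**: `B₃′·(cR·ε_m) ≤ B·C·M_r·α₀(g_m)`, `1 ≤ m ≤ n`. [cite: Balaban1988Convergent, (2.38) p.261, (2.4) p.255, (2.28) p.259] -/
theorem htMS_theta13OfThm1CCMWZB_chi (hγ : γ ≤ 1 / 2) (hB : 0 ≤ B₃) (hB' : 0 ≤ B₃') (ha₀ : 0 ≤ a₀) (ha₁ : 0 ≤ a₁) :
    ∀ (p : B12.RunParams) (n : ℕ), n ≤ p.K → Step.InInterval (theta13OfThm1CCMWZBChi F N j γ εbg ε₀ ε₂₉ B₃ B₃' a₀ a₁ Efl logz χ).γ n (gOfRecord₁₃Chi F N (theta13OfThm1CCMWZBChi F N j γ εbg ε₀ ε₂₉ B₃ B₃' a₀ a₁ Efl logz χ) χ p) → ∀ m, 1 ≤ m → m ≤ n →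
      B₃' * ((theta13OfThm1CCMWZBChi F N j γ εbg ε₀ ε₂₉ B₃ B₃' a₀ a₁ Efl logz χ).s2.cR * epsOfRecord (theta13OfThm1CCMWZBChi F N j γ εbg ε₀ ε₂₉ B₃ B₃' a₀ a₁ Efl logz χ).ν (gOfRecord₁₃Chi F N (theta13OfThm1CCMWZBChi F N j γ εbg ε₀ ε₂₉ B₃ B₃' a₀ a₁ Efl logz χ) χ p) m) ≤
        (theta13OfThm1CCMWZBChi F N j γ εbg ε₀ ε₂₉ B₃ B₃' a₀ a₁ Efl logz χ).s2.B * (theta13OfThm1CCMWZBChi F N j γ εbg ε₀ ε₂₉ B₃ B₃' a₀ a₁ Efl logz χ).s2.C * (theta13OfThm1CCMWZBChi F N j γ εbg ε₀ ε₂₉ B₃ B₃' a₀ a₁ Efl logz χ).s2.Mr * (lfOfRecord₁₂ F N (theta13OfThm1CCMWZBChi F N j γ εbg ε₀ ε₂₉ B₃ B₃' a₀ a₁ Efl logz χ).toStage12Params).alpha0 (gOfRecord₁₃Chi F N (theta13OfThm1CCMWZBChi F N j γ εbg ε₀ ε₂₉ B₃ B₃' a₀ a₁ Efl logz χ) χ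 p m) :=
  fun p n hn hw => gaugeLetter_of_numerics (lfOfRecord₁₂ F N (theta13OfThm1CCMWZBChi F N j γ εbg ε₀ ε₂₉ B₃ B₃' a₀ a₁ Efl logz χ).toStage12Params) (theta13OfThm1CCMWZBChi F N j γ εbg ε₀ ε₂₉ B₃ B₃' a₀ a₁ Efl logz χ).ν
    (fun m _ hm => hg_theta13OfThm1CCMWZB_chi hγ p n hn hw m hm) hpq_theta13OfThm1CCMWZB_chi (gauge_mul_A0_nonneg_thm1CCMWZB_chi hB hB' ha₀ ha₁) (gauge_mul_A0_le_BCM_C₀_thm1CCMWZB_chi hB hB' ha₀ ha₁)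

end FacesChi

/-! ## §4. The pins, the collar letter and the non-wrapping letter at `θ₁₅ᶜᶜᴹᵂᶻᴮ(j; γ; εbg)` — window-blind (A2's theorems re-read; `τ9.M = ν.M₁ = L^j` by `rfl` on both members) -/

section PinsChi

variable (F : T4Family) (N : ℕ) [NeZero N] (j : ℕ) (γ εbg ε₀ ε₂₉ B₃ B₃' a₀ a₁ : ℝ) (Efl logz : B12.RunParams → ℕ → ℝ) (χ : ChiSlot F N)

/-- `0 < θ₁₅ᶜᶜᴹᵂᶻᴮ(j; γ; εbg).τ9.M`. [cite: Balaban1989LargeFieldI, (2.1) p.182 (bookkeeping)] -/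
theorem τ9_M_pos_theta13OfThm1CCMWZB_chi : 0 < (theta13OfThm1CCMWZBChi F N j γ εbg ε₀ ε₂₉ B₃ B₃' a₀ a₁ Efl logz χ).τ9.M := τ9_M_pos_theta13OfThm1CCM F N j ε₀ ε₂₉ B₃ B₃' a₀ a₁

/-- `0 < θ₁₅ᶜᶜᴹᵂᶻᴮ(j; γ; εbg).ν.M₁` — the binder `0 < ν.M₁` of the step facts. [cite: Balaban1985RegularSpaces, (1.3)–(1.6) p.77 (bookkeeping)] -/
theorem M₁_pos_theta13OfThm1CCMWZB_chi : 0 < (theta13OfThm1CCMWZBChi F N j γ εbg ε₀ ε₂₉ B₃ B₃' a₀ a₁ Efl logz χ).ν.M₁ := M₁_pos_theta13OfThm1CCM F N j ε₀ ε₂₉ B₃ B₃' a₀ a₁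

/-- **THE PIN `hM`**: the cube letter is a power of `L` (`⟨j, rfl⟩`). [cite: Balaban1988Convergent, (2.18) p.257, p.245 (bookkeeping)] -/
theorem hM_theta13OfThm1CCMWZB_chi : ∃ a : ℕ, (theta13OfThm1CCMWZBChi F N j γ εbg ε₀ ε₂₉ B₃ B₃' a₀ a₁ Efl logz χ).τ9.M = F.L ^ a := ⟨j, rfl⟩

/-- **THE PIN `hM₁`**: `M₁ ∣ M` (`L^j ∣ L^j`). [cite: Balaban1988Convergent, (2.13) p.256, (2.18) p.257 (bookkeeping)] -/
theorem hM₁_theta13OfThm1CCMWZB_chi : (theta13OfThm1CCMWZBChi F N j γ εbg ε₀ ε₂₉ B₃ B₃' a₀ a₁ Efl logz χ).ν.M₁ ∣ (theta13OfThm1CCMWZBChi F N j γ εbg ε₀ ε₂₉ B₃ B₃' a₀ a₁ Efl logz χ).τ9.M := dvd_refl _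

variable {j} in
/-- **★ THE COLLAR LETTER OF THE R-ROAD AT `θ₁₅ᶜᶜᴹᵂᶻᴮ(j; γ; εbg)`**: `(11·4 + 3·L)·L ≤ ν.M₁` for every `j ≥ 3` (A2's, window-blind). [cite: Balaban1985RegularSpaces, Prop. 6 p.99, (1.130) p.99, (1.3)–(1.6) p.77; Balaban1985Variational, (144) p.300 (bookkeeping)] -/
theorem collar_le_M₁_theta13OfThm1CCMWZB_chi (hj : 3 ≤ j) : (11 * 4 + 3 * F.L) * F.L ≤ (theta13OfThm1CCMWZBChi F N j γ εbg ε₀ ε₂₉ B₃ B₃' a₀ a₁ Efl logz χ).ν.M₁ :=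
  collar_le_M₁_theta13OfThm1CCM F N ε₀ ε₂₉ B₃ B₃' a₀ a₁ hj

variable {j} in
/-- The collar letter in the `Setup.Params` letters of every torus of the family. [cite: Balaban1985RegularSpaces, Prop. 6 p.99 (bookkeeping)] -/
theorem collar_le_M₁_theta13OfThm1CCMWZB'_chi (hj : 3 ≤ j) (K : ℕ) :
    (11 * (F.P K).d + 3 * (F.P K).L) * (F.P K).L ≤ (theta13OfThm1CCMWZBChi F N j γ εbg ε₀ ε₂₉ B₃ B₃' a₀ a₁ Efl logz χ).ν.M₁ :=
  collar_le_M₁_theta13OfThm1CCMWZB_chi F N γ εbg ε₀ ε₂₉ B₃ B₃' a₀ a₁ Efl logz χ hj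

variable {j} in
/-- **★ NO WRAPPING AT `θ₁₅ᶜᶜᴹᵂᶻᴮ(j; γ; εbg)` UNDER `j + 1 ≤ F.m`** (A2's, window-blind). [cite: Balaban1987RG1, (0.1) p.251; Balaban1988Convergent, p.257 (bookkeeping)] -/
theorem hsN_theta13OfThm1CCMWZB_chi (hjm : j + 1 ≤ F.m) :
     ∀ (p : B12.RunParams) (n : ℕ), n ≤ p.K → ∀ n', 1 ≤ n' → n' ≤ n + 1 →
      ((B14.Eq213MaximalDomains.side (F.P p.K).L (theta13OfThm1CCMWZBChi F N j γ εbg ε₀ ε₂₉ B₃ B₃' a₀ a₁ Efl logz χ).τ9.M n' : ℕ) : ℤ) < (F.P p.K).sitesPerDir 0 :=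
  hsN_theta13OfThm1CCM F N ε₀ ε₂₉ B₃ B₃' a₀ a₁ hjm

variable {j} in
/-- **THE CERTIFICATE OF (δ) AT `θ₁₅ᶜᶜᴹᵂᶻᴮ(j; γ; εbg)`** (window-blind): if `F.m ≤ j` the top [I]-cube wraps on every run. [cite: Balaban1987RG1, (0.1) p.251; Balaban1988Convergent, p.257 (bookkeeping certificate)] -/
theorem exists_wrap_theta13OfThm1CCMWZB_of_le_chi (hmj : F.m ≤ j) (p : B12.RunParams) :
    ∃ n n', n ≤ p.K ∧ 1 ≤ n' ∧ n' ≤ n + 1 ∧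
      ¬ ((B14.Eq213MaximalDomains.side (F.P p.K).L (theta13OfThm1CCMWZBChi F N j γ εbg ε₀ ε₂₉ B₃ B₃' a₀ a₁ Efl logz χ).τ9.M n' : ℕ) : ℤ) < (F.P p.K).sitesPerDir 0 :=
  exists_wrap_theta13OfThm1CCM_of_le F N ε₀ ε₂₉ B₃ B₃' a₀ a₁ hmj p

variable {j} in
/-- … so the universally quantified non-wrapping binder fails outright when `F.m ≤ j`. [cite: Balaban1987RG1, (0.1) p.251; Balaban1988Convergent, p.257 (bookkeeping certificate)] -/
theorem not_hsN_theta13OfThm1CCMWZB_of_le_chi (hmj : F.m ≤ j) (p : B12.RunParams) :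
    ¬ ∀ n, n ≤ p.K → ∀ n', 1 ≤ n' → n' ≤ n + 1 →
      ((B14.Eq213MaximalDomains.side (F.P p.K).L (theta13OfThm1CCMWZBChi F N j γ εbg ε₀ ε₂₉ B₃ B₃' a₀ a₁ Efl logz χ).τ9.M n' : ℕ) : ℤ) < (F.P p.K).sitesPerDir 0 :=
  not_hsN_theta13OfThm1CCM_of_le F N ε₀ ε₂₉ B₃ B₃' a₀ a₁ hmj p

/-- **THE NON-WRAPPING BINDER AT `θ₁₅ᶜᶜᴹᵂᶻᴮ(j; γ; εbg)` IS EQUIVALENT TO `j + 1 ≤ F.m`** ((δ) is window-blind). [cite: Balaban1987RG1, (0.1) p.251; Balaban1988Convergent, p.257 (bookkeeping certificate)] -/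
theorem hsN_theta13OfThm1CCMWZB_iff_chi (p : B12.RunParams) :
    (∀ n, n ≤ p.K → ∀ n', 1 ≤ n' → n' ≤ n + 1 →
      ((B14.Eq213MaximalDomains.side (F.P p.K).L (theta13OfThm1CCMWZBChi F N j γ εbg ε₀ ε₂₉ B₃ B₃' a₀ a₁ Efl logz χ).τ9.M n' : ℕ) : ℤ) < (F.P p.K).sitesPerDir 0) ↔ j + 1 ≤ F.m :=
  hsN_theta13OfThm1CCM_iff F N j ε₀ ε₂₉ B₃ B₃' a₀ a₁ p

end PinsChi

/-! ## §5. ★★ THE β TRANSFER: on the box `]0, γ]`, `γ ≤ ½`, the β-functions of record of `θ₁₅ᶜᶜᴹᵂᶻᴮ(j; γ; εbg)` and of the half-window member `θ₁₅ᶜᶜᴹᵂᶻᴮ(j; ½; εbg)` coincide -/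

section TransferChi

variable {F : T4Family} {N : ℕ} [NeZero N] {j : ℕ} {γ εbg ε₀ ε₂₉ B₃ B₃' a₀ a₁ : ℝ} {Efl logz : B12.RunParams → ℕ → ℝ} {χ : ChiSlot F N}

/-- A history in `]0, γ]^{k+1}` is in `]0, γ′]^{k+1}` for `γ ≤ γ′`. [folklore] -/
private theorem mem_box_of_le {γ γ' : ℝ} (h : γ ≤ γ') {k : ℕ} {v : Fin (k + 1) → ℝ} (hv : v ∈ Box γ k) : v ∈ Box γ' k :=
  FlowStep.mem_box.mpr fun i => ⟨(FlowStep.mem_box.mp hv i).1, (FlowStep.mem_box.mp hv i).2.trans h⟩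

/-- **★★ THE β TRANSFER**: for `γ ≤ ½` and every history `v ∈ ]0, γ]^{k+1}`, `β₁₃(θ₁₅ᶜᶜᴹᵂᶻᴮ(j; γ; εbg)) k v = β₁₃(θ₁₅ᶜᶜᴹ(j)) k v` — both witnesses carry the same Stage-7 numerics, (2.9)
threshold, background radius, chart, basis and base histories, so [I] (1.20)–(1.22) on the merged term (1.6) give ONE function `β_merged`, and both box conventions read it on
`]0, γ] ⊆ ]0, ½]` (`betaOfMerged_of_mem`). [cite: Balaban1987RG1, (1.20)–(1.22) p.264, (1.6) p.261, (2.12)–(2.14) p.268] -/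
theorem betaOfRecord₁₃_theta13OfThm1CCMWZB_eq_of_mem_chi (hγ : γ ≤ 1 / 2) {k : ℕ} {v : Fin (k + 1) → ℝ} (hv : v ∈ Box γ k) :
    betaOfRecord₁₃Chi F N (theta13OfThm1CCMWZBChi F N j γ εbg ε₀ ε₂₉ B₃ B₃' a₀ a₁ Efl logz χ) χ k v = betaOfRecord₁₃Chi F N (theta13OfThm1CCMWZBChi F N j (1 / 2) εbg ε₀ ε₂₉ B₃ B₃' a₀ a₁ Efl logz χ) χ k v := by
  have hv' : v ∈ Box (1 / 2 : ℝ) k := mem_box_of_le hγ hv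
  show betaOfMerged _ _ γ k v = betaOfMerged _ _ (1 / 2 : ℝ) k v
  rw [betaOfMerged_of_mem _ _ _ hv, betaOfMerged_of_mem _ _ _ hv']
  rfl

/-- **A LOWER β-BOUND OF THE HALF-WINDOW MEMBER ON `]0, γ]` IS ONE OF THE WINDOW EDITION** (`γ ≤ ½`). [cite: Balaban1987RG1, (1.20)–(1.22) p.264, §1 p.264; Balaban1989LargeFieldII, (1.4) p.357] -/
theorem betaLowerH_theta13OfThm1CCMWZB_of_half_chi (hγ : γ ≤ 1 / 2) {b : ℝ} (h : BetaLowerH b γ (betaOfRecord₁₃Chi F N (theta13OfThm1CCMWZBChi F N j (1 / 2) εbg ε₀ ε₂₉ B₃ B₃' a₀ a₁ Efl logz χ) χ)) :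
    BetaLowerH b γ (betaOfRecord₁₃Chi F N (theta13OfThm1CCMWZBChi F N j γ εbg ε₀ ε₂₉ B₃ B₃' a₀ a₁ Efl logz χ) χ) :=
  fun k v hv => by rw [betaOfRecord₁₃_theta13OfThm1CCMWZB_eq_of_mem_chi hγ hv]; exact h k v hv

/-- **AN UPPER β-BOUND OF THE HALF-WINDOW MEMBER ON `]0, γ]` IS ONE OF THE WINDOW EDITION** (`γ ≤ ½`). [cite: Balaban1987RG1, (1.20)–(1.22) p.264, §1 p.264 («uniformly bounded»)] -/
theorem betaUpperH_theta13OfThm1CCMWZB_of_half_chi (hγ : γ ≤ 1 / 2) {β' : ℝ} (h : BetaUpperH β' γ (betaOfRecord₁₃Chi F N (theta13OfThm1CCMWZBChi F N j (1 / 2) εbg ε₀ ε₂₉ B₃ B₃' a₀ a₁ Efl logz χ) χ)) :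
    BetaUpperH β' γ (betaOfRecord₁₃Chi F N (theta13OfThm1CCMWZBChi F N j γ εbg ε₀ ε₂₉ B₃ B₃' a₀ a₁ Efl logz χ) χ) :=
  fun k v hv => by rw [betaOfRecord₁₃_theta13OfThm1CCMWZB_eq_of_mem_chi hγ hv]; exact h k v hv

/-- … and conversely (the transfer is an equality on the box). [cite: Balaban1987RG1, (1.20)–(1.22) p.264 (bookkeeping)] -/
theorem betaLowerH_half_of_theta13OfThm1CCMWZB_chi (hγ : γ ≤ 1 / 2) {b : ℝ} (h : BetaLowerH b γ (betaOfRecord₁₃Chi F N (theta13OfThm1CCMWZBChi F N j γ εbg ε₀ ε₂₉ B₃ B₃' a₀ a₁ Efl logz χ) χ)) :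
    BetaLowerH b γ (betaOfRecord₁₃Chi F N (theta13OfThm1CCMWZBChi F N j (1 / 2) εbg ε₀ ε₂₉ B₃ B₃' a₀ a₁ Efl logz χ) χ) :=
  fun k v hv => by rw [← betaOfRecord₁₃_theta13OfThm1CCMWZB_eq_of_mem_chi (j := j) (γ := γ) hγ hv]; exact h k v hv

/-- … and conversely for the upper bound. [cite: Balaban1987RG1, (1.20)–(1.22) p.264 (bookkeeping)] -/
theorem betaUpperH_half_of_theta13OfThm1CCMWZB_chi (hγ : γ ≤ 1 / 2) {β' : ℝ} (h : BetaUpperH β' γ (betaOfRecord₁₃Chi F N (theta13OfThm1CCMWZBChi F N j γ εbg ε₀ ε₂₉ B₃ B₃' a₀ a₁ Efl logz χ) χ)) :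
    BetaUpperH β' γ (betaOfRecord₁₃Chi F N (theta13OfThm1CCMWZBChi F N j (1 / 2) εbg ε₀ ε₂₉ B₃ B₃' a₀ a₁ Efl logz χ) χ) :=
  fun k v hv => by rw [← betaOfRecord₁₃_theta13OfThm1CCMWZB_eq_of_mem_chi (j := j) (γ := γ) hγ hv]; exact h k v hv

end TransferChi

/-! ## §6. The two history clauses at `θ₁₅ᶜᶜᴹᵂᶻᴮ(j; γ; εbg)` from the β-box on `]0, γ]` (13e ∕ 14d are θ-generic), and ★ from the β-box of the half-window member on `]0, γ]` -/

section HistoryChi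

variable {F : T4Family} {N : ℕ} [NeZero N] {j : ℕ} {γ εbg ε₀ ε₂₉ B₃ B₃' a₀ a₁ : ℝ} {Efl logz : B12.RunParams → ℕ → ℝ} {χ : ChiSlot F N}

/-- **(hmono) AT `θ₁₅ᶜᶜᴹᵂᶻᴮ(j; γ; εbg)` from `BetaLowerH b γ β₁₃(θ₁₅ᶜᶜᴹᵂᶻᴮ(j; γ; εbg))`, `0 ≤ b`**. [cite: Balaban1987RG1, (0.20) p.256, §1 p.264; Balaban1988Convergent, (2.6) p.255] -/
theorem hmono_theta13OfThm1CCMWZB_of_betaLowerH_chi {b : ℝ} (hb : 0 ≤ b) (hlow : BetaLowerH b γ (betaOfRecord₁₃Chi F N (theta13OfThm1CCMWZBChi F N j γ εbg ε₀ ε₂₉ B₃ B₃' a₀ a₁ Efl logz χ) χ)) :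
    ∀ (p : B12.RunParams) (n : ℕ), n ≤ p.K → Step.InInterval (theta13OfThm1CCMWZBChi F N j γ εbg ε₀ ε₂₉ B₃ B₃' a₀ a₁ Efl logz χ).γ n (gOfRecord₁₃Chi F N (theta13OfThm1CCMWZBChi F N j γ εbg ε₀ ε₂₉ B₃ B₃' a₀ a₁ Efl logz χ) χ p) → ∀ m, m < n →
      gOfRecord₁₃Chi F N (theta13OfThm1CCMWZBChi F N j γ εbg ε₀ ε₂₉ B₃ B₃' a₀ a₁ Efl logz χ) χ p m ≤ gOfRecord₁₃Chi F N (theta13OfThm1CCMWZBChi F N j γ εbg ε₀ ε₂₉ B₃ B₃' a₀ a₁ Efl logz χ) χ p (m + 1) :=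
  (theta13OfThm1CCMWZBChi F N j γ εbg ε₀ ε₂₉ B₃ B₃' a₀ a₁ Efl logz χ).hmono_of_betaLowerH_chi χ hb ((theta13OfThm1CCMWZBChi_γ F N j γ εbg ε₀ ε₂₉ B₃ B₃' a₀ a₁ Efl logz χ).symm ▸ hlow)

/-- **(hcomp) AT `θ₁₅ᶜᶜᴹᵂᶻᴮ(j; γ; εbg)` FROM THE β-SIGN LEAF** on `]0, γ]`, `γ ≤ ½`. [cite: Balaban1988Convergent, (2.4) p.255, (2.6)–(2.8) pp.255–256; Balaban1987RG1, (0.20) p.256, §1 p.264] -/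
theorem hcomp_theta13OfThm1CCMWZB_of_betaLowerH_chi (hγ : γ ≤ 1 / 2) (hB : 0 ≤ B₃) (hB' : 0 ≤ B₃') (ha₀ : 0 ≤ a₀) (ha₁ : 0 ≤ a₁)
    {b : ℝ} (hb : 0 ≤ b) (hlow : BetaLowerH b γ (betaOfRecord₁₃Chi F N (theta13OfThm1CCMWZBChi F N j γ εbg ε₀ ε₂₉ B₃ B₃' a₀ a₁ Efl logz χ) χ)) :
    ∀ (p : B12.RunParams) (n : ℕ), n ≤ p.K → Step.InInterval (theta13OfThm1CCMWZBChi F N j γ εbg ε₀ ε₂₉ B₃ B₃' a₀ a₁ Efl logz χ).γ n (gOfRecord₁₃Chi F N (theta13OfThm1CCMWZBChi F N j γ εbg ε₀ ε₂₉ B₃ B₃' a₀ a₁ Efl logz χ) χ p) → ∀ m, m < n →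
      (theta13OfThm1CCMWZBChi F N j γ εbg ε₀ ε₂₉ B₃ B₃' a₀ a₁ Efl logz χ).s2.cR * epsOfRecord (theta13OfThm1CCMWZBChi F N j γ εbg ε₀ ε₂₉ B₃ B₃' a₀ a₁ Efl logz χ).ν (gOfRecord₁₃Chi F N (theta13OfThm1CCMWZBChi F N j γ εbg ε₀ ε₂₉ B₃ B₃' a₀ a₁ Efl logz χ) χ p) m ≤ 2 * ((theta13OfThm1CCMWZBChi F N j γ εbg ε₀ ε₂₉ B₃ B₃' a₀ a₁ Efl logz χ).s2.cR * epsOfRecord (theta13OfThm1CCMWZBChi F N j γ εbg ε₀ ε₂₉ B₃ B₃' a₀ a₁ Efl logz χ).ν (gOfRecord₁₃Chi F N (theta13OfThm1CCMWZBChi F N j γ εbg ε₀ ε₂₉ B₃ B₃' a₀ a₁ Efl logz χ) χ p) (m + 1)) :=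
  hcomp_theta13OfThm1CCMWZB_of_monotone_chi hγ hB hB' ha₀ ha₁ (hmono_theta13OfThm1CCMWZB_of_betaLowerH_chi hb hlow)

/-- **★★ THE REVERSE COMPARABILITY CLAUSE AT `θ₁₅ᶜᶜᴹᵂᶻᴮ(j; γ; εbg)`** (`γ ≤ ½ ≤ 1`, `cR = 1`, `A₀ = A₀ᶜᶜ¹ ≥ 0`) from the β-box on `]0, γ]` with `0 ≤ b` and the 14d letter `β′·γ² ≤ ¾`.
CONDITIONAL on the displayed β-box; nothing of Bałaban asserted. [cite: Balaban1988Convergent, (2.4) p.255, (2.6)–(2.8) pp.255–256; Balaban1987RG1, (0.20) p.256, §1 p.264; Balaban1985Variational, Thm 1 p.279] -/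
theorem hcompRev_theta13OfThm1CCMWZB_of_betaBox_chi (hγ : γ ≤ 1 / 2) (hB : 0 ≤ B₃) (hB' : 0 ≤ B₃') (ha₀ : 0 ≤ a₀) (ha₁ : 0 ≤ a₁)
    {b β' : ℝ} (hb : 0 ≤ b) (hlow : BetaLowerH b γ (betaOfRecord₁₃Chi F N (theta13OfThm1CCMWZBChi F N j γ εbg ε₀ ε₂₉ B₃ B₃' a₀ a₁ Efl logz χ) χ))
    (hup : BetaUpperH β' γ (betaOfRecord₁₃Chi F N (theta13OfThm1CCMWZBChi F N j γ εbg ε₀ ε₂₉ B₃ B₃' a₀ a₁ Efl logz χ) χ)) (hletter : β' * γ ^ 2 ≤ 3 / 4) :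
    ∀ (p : B12.RunParams) (n : ℕ), n ≤ p.K → Step.InInterval (theta13OfThm1CCMWZBChi F N j γ εbg ε₀ ε₂₉ B₃ B₃' a₀ a₁ Efl logz χ).γ n (gOfRecord₁₃Chi F N (theta13OfThm1CCMWZBChi F N j γ εbg ε₀ ε₂₉ B₃ B₃' a₀ a₁ Efl logz χ) χ p) → ∀ m, m < n →
      (theta13OfThm1CCMWZBChi F N j γ εbg ε₀ ε₂₉ B₃ B₃' a₀ a₁ Efl logz χ).s2.cR * epsOfRecord (theta13OfThm1CCMWZBChi F N j γ εbg ε₀ ε₂₉ B₃ B₃' a₀ a₁ Efl logz χ).ν (gOfRecord₁₃Chi F N (theta13OfThm1CCMWZBChi F N j γ εbg ε₀ ε₂₉ B₃ B₃' a₀ a₁ Efl logz χ) χ p) (m + 1) ≤ 2 * ((theta13OfThm1CCMWZBChi F N j γ εbg ε₀ ε₂₉ B₃ B₃' a₀ a₁ Efl logz χ).s2.cR * epsOfRecord (theta13OfThm1CCMWZBChi F N j γ εbg ε₀ ε₂₉ B₃ B₃' a₀ a₁ Efl logz χ).ν (gOfRecord₁₃Chi F N (theta13OfThm1CCMWZBChi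 F N j γ εbg ε₀ ε₂₉ B₃ B₃' a₀ a₁ Efl logz χ) χ p) m) :=
  (theta13OfThm1CCMWZBChi F N j γ εbg ε₀ ε₂₉ B₃ B₃' a₀ a₁ Efl logz χ).hcompRev_of_betaBox_chi χ (by rw [theta13OfThm1CCMWZBChi_A₀]; exact A0OfThm1CC1_nonneg hB hB' ha₀ ha₁)
    (by rw [theta13OfThm1CCMWZBChi_γ]; linarith) (by rw [theta13OfThm1CCMWZBChi_cR]; norm_num) hb ((theta13OfThm1CCMWZBChi_γ F N j γ εbg ε₀ ε₂₉ B₃ B₃' a₀ a₁ Efl logz χ).symm ▸ hlow)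
    ((theta13OfThm1CCMWZBChi_γ F N j γ εbg ε₀ ε₂₉ B₃ B₃' a₀ a₁ Efl logz χ).symm ▸ hup) (by rw [theta13OfThm1CCMWZBChi_γ]; exact hletter)

/-- **★★ (hmono) AT `θ₁₅ᶜᶜᴹᵂᶻᴮ(j; γ; εbg)` FROM THE β-SIGN OF THE HALF-WINDOW MEMBER ON `]0, γ]`** (§5 transfer, `γ ≤ ½`). [cite: Balaban1987RG1, (0.20) p.256, (1.20)–(1.22) p.264; Balaban1989LargeFieldII, (1.4) p.357] -/
theorem hmono_theta13OfThm1CCMWZB_of_betaLowerH_half_chi (hγ : γ ≤ 1 / 2) {b : ℝ} (hb : 0 ≤ b)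
    (hlow : BetaLowerH b γ (betaOfRecord₁₃Chi F N (theta13OfThm1CCMWZBChi F N j (1 / 2) εbg ε₀ ε₂₉ B₃ B₃' a₀ a₁ Efl logz χ) χ)) :
    ∀ (p : B12.RunParams) (n : ℕ), n ≤ p.K → Step.InInterval (theta13OfThm1CCMWZBChi F N j γ εbg ε₀ ε₂₉ B₃ B₃' a₀ a₁ Efl logz χ).γ n (gOfRecord₁₃Chi F N (theta13OfThm1CCMWZBChi F N j γ εbg ε₀ ε₂₉ B₃ B₃' a₀ a₁ Efl logz χ) χ p) → ∀ m, m < n →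
      gOfRecord₁₃Chi F N (theta13OfThm1CCMWZBChi F N j γ εbg ε₀ ε₂₉ B₃ B₃' a₀ a₁ Efl logz χ) χ p m ≤ gOfRecord₁₃Chi F N (theta13OfThm1CCMWZBChi F N j γ εbg ε₀ ε₂₉ B₃ B₃' a₀ a₁ Efl logz χ) χ p (m + 1) :=
  hmono_theta13OfThm1CCMWZB_of_betaLowerH_chi hb (betaLowerH_theta13OfThm1CCMWZB_of_half_chi hγ hlow)

/-- **★★ THE REVERSE COMPARABILITY CLAUSE AT `θ₁₅ᶜᶜᴹᵂᶻᴮ(j; γ; εbg)` FROM THE β-BOX OF THE HALF-WINDOW MEMBER ON `]0, γ]`** (`γ ≤ ½`, `0 ≤ b`, `β′·γ² ≤ ¾`; §5 transfer ∘ 14d).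
[cite: Balaban1988Convergent, (2.6)–(2.8) pp.255–256; Balaban1987RG1, (0.20) p.256, (1.20)–(1.22) p.264, §1 p.264] -/
theorem hcompRev_theta13OfThm1CCMWZB_of_betaBox_half_chi (hγ : γ ≤ 1 / 2) (hB : 0 ≤ B₃) (hB' : 0 ≤ B₃') (ha₀ : 0 ≤ a₀) (ha₁ : 0 ≤ a₁)
    {b β' : ℝ} (hb : 0 ≤ b) (hlow : BetaLowerH b γ (betaOfRecord₁₃Chi F N (theta13OfThm1CCMWZBChi F N j (1 / 2) εbg ε₀ ε₂₉ B₃ B₃' a₀ a₁ Efl logz χ) χ))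
    (hup : BetaUpperH β' γ (betaOfRecord₁₃Chi F N (theta13OfThm1CCMWZBChi F N j (1 / 2) εbg ε₀ ε₂₉ B₃ B₃' a₀ a₁ Efl logz χ) χ)) (hletter : β' * γ ^ 2 ≤ 3 / 4) :
    ∀ (p : B12.RunParams) (n : ℕ), n ≤ p.K → Step.InInterval (theta13OfThm1CCMWZBChi F N j γ εbg ε₀ ε₂₉ B₃ B₃' a₀ a₁ Efl logz χ).γ n (gOfRecord₁₃Chi F N (theta13OfThm1CCMWZBChi F N j γ εbg ε₀ ε₂₉ B₃ B₃' a₀ a₁ Efl logz χ) χ p) → ∀ m, m < n →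
      (theta13OfThm1CCMWZBChi F N j γ εbg ε₀ ε₂₉ B₃ B₃' a₀ a₁ Efl logz χ).s2.cR * epsOfRecord (theta13OfThm1CCMWZBChi F N j γ εbg ε₀ ε₂₉ B₃ B₃' a₀ a₁ Efl logz χ).ν (gOfRecord₁₃Chi F N (theta13OfThm1CCMWZBChi F N j γ εbg ε₀ ε₂₉ B₃ B₃' a₀ a₁ Efl logz χ) χ p) (m + 1) ≤ 2 * ((theta13OfThm1CCMWZBChi F N j γ εbg ε₀ ε₂₉ B₃ B₃' a₀ a₁ Efl logz χ).s2.cR * epsOfRecord (theta13OfThm1CCMWZBChi F N j γ εbg ε₀ ε₂₉ B₃ B₃' a₀ a₁ Efl logz χ).ν (gOfRecord₁₃Chi F N (theta13OfThm1CCMWZBChi F N j γ εbg ε₀ ε₂₉ B₃ B₃' a₀ a₁ Efl logz χ) χ p) m) :=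
  hcompRev_theta13OfThm1CCMWZB_of_betaBox_chi hγ hB hB' ha₀ ha₁ hb (betaLowerH_theta13OfThm1CCMWZB_of_half_chi hγ hlow) (betaUpperH_theta13OfThm1CCMWZB_of_half_chi hγ hup) hletter

end HistoryChi

/-! ## §6′. ★ The SIGN-FREE pair at `θ₁₅ᶜᶜᴹᵂᶻᴮ(j; γ; εbg)` (node O P3 g48 ∕ dag-n21-c `Record13SignFreeComparabilityOfBetaBox` §4ʷ, token-pass; §3 there is θ-generic): (hcomp) ∧ (hcompRev) from a two-sided box `bₗ ≤ β ≤ β′` of ANY sign -/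

section SignFreeChi

variable {F : T4Family} {N : ℕ} [NeZero N] {j : ℕ} {γ εbg ε₀ ε₂₉ B₃ B₃' a₀ a₁ : ℝ} {Efl logz : B12.RunParams → ℕ → ℝ} {χ : ChiSlot F N}

/-- **★ʷ (hcomp) ∧ (hcompRev) AT `θ₁₅ᶜᶜᴹᵂᶻᴮ(j; γ; εbg)` FROM THE SIGN-FREE β-BOX OF ITS OWN β-FUNCTIONS ON `]0, γ]`** (`γ ≤ ½`; `bₗ`, `β′` of any sign with `−bₗ·γ² ≤ 3`, `β′·γ² ≤ ¾`; weak signs of the class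
constants) — §3 at `θ := θ₁₅ᶜᶜᴹᵂᶻᴮ(j; γ; εbg)`.  The sign-free twin of §6 (node O P3 g48's observation, tree file `Record13SignFreeComparabilityOfBetaBox` §4ʷ, token-pass).  CONDITIONAL on the displayed box.  (node O P3 g48 §4ʷ at Z3.) [cite: Balaban1988Convergent, (2.4) p.255, (2.6)–(2.8) pp.255–256; Balaban1987RG1, (0.20) p.256, §1 p.264] -/
theorem hcompBoth_theta13OfThm1CCMWZB_of_betaBoxSignFree_chi (hγ : γ ≤ 1 / 2) (hB : 0 ≤ B₃) (hB' : 0 ≤ B₃') (ha₀ : 0 ≤ a₀) (ha₁ : 0 ≤ a₁) {bl β' : ℝ}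
    (hlow : BetaLowerH bl γ (betaOfRecord₁₃Chi F N (theta13OfThm1CCMWZBChi F N j γ εbg ε₀ ε₂₉ B₃ B₃' a₀ a₁ Efl logz χ) χ))
    (hup : BetaUpperH β' γ (betaOfRecord₁₃Chi F N (theta13OfThm1CCMWZBChi F N j γ εbg ε₀ ε₂₉ B₃ B₃' a₀ a₁ Efl logz χ) χ)) (hl : -bl * γ ^ 2 ≤ 3) (hu : β' * γ ^ 2 ≤ 3 / 4) :
    (∀ (p : B12.RunParams) (n : ℕ), n ≤ p.K → Step.InInterval (theta13OfThm1CCMWZBChi F N j γ εbg ε₀ ε₂₉ B₃ B₃' a₀ a₁ Efl logz χ).γ n (gOfRecord₁₃Chi F N (theta13OfThm1CCMWZBChi F N j γ εbg ε₀ ε₂₉ B₃ B₃' a₀ a₁ Efl logz χ) χ p) → ∀ m, m < n →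
      (theta13OfThm1CCMWZBChi F N j γ εbg ε₀ ε₂₉ B₃ B₃' a₀ a₁ Efl logz χ).s2.cR * epsOfRecord (theta13OfThm1CCMWZBChi F N j γ εbg ε₀ ε₂₉ B₃ B₃' a₀ a₁ Efl logz χ).ν (gOfRecord₁₃Chi F N (theta13OfThm1CCMWZBChi F N j γ εbg ε₀ ε₂₉ B₃ B₃' a₀ a₁ Efl logz χ) χ p) m ≤ 2 * ((theta13OfThm1CCMWZBChi F N j γ εbg ε₀ ε₂₉ B₃ B₃' a₀ a₁ Efl logz χ).s2.cR * epsOfRecord (theta13OfThm1CCMWZBChi F N j γ εbg ε₀ ε₂₉ B₃ B₃' a₀ a₁ Efl logz χ).ν (gOfRecord₁₃Chi F N (theta13OfThm1CCMWZBChi F N j γ εbg ε₀ ε₂₉ B₃ B₃' a₀ a₁ Efl logz χ) χ p) (m + 1))) ∧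
    (∀ (p : B12.RunParams) (n : ℕ), n ≤ p.K → Step.InInterval (theta13OfThm1CCMWZBChi F N j γ εbg ε₀ ε₂₉ B₃ B₃' a₀ a₁ Efl logz χ).γ n (gOfRecord₁₃Chi F N (theta13OfThm1CCMWZBChi F N j γ εbg ε₀ ε₂₉ B₃ B₃' a₀ a₁ Efl logz χ) χ p) → ∀ m, m < n →
      (theta13OfThm1CCMWZBChi F N j γ εbg ε₀ ε₂₉ B₃ B₃' a₀ a₁ Efl logz χ).s2.cR * epsOfRecord (theta13OfThm1CCMWZBChi F N j γ εbg ε₀ ε₂₉ B₃ B₃' a₀ a₁ Efl logz χ).ν (gOfRecord₁₃Chi F N (theta13OfThm1CCMWZBChi F N j γ εbg ε₀ ε₂₉ B₃ B₃' a₀ a₁ Efl logz χ) χ p) (m + 1) ≤ 2 * ((theta13OfThm1CCMWZBChi F N j γ εbg ε₀ ε₂₉ B₃ B₃' a₀ a₁ Efl logz χ).s2.cR * epsOfRecord (theta13OfThm1CCMWZBChi F N j γ εbg ε₀ ε₂₉ B₃ B₃' a₀ a₁ Efl logz χ).ν (gOfRecord₁₃Chi F N (theta13OfThm1CCMWZBChi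 F N j γ εbg ε₀ ε₂₉ B₃ B₃' a₀ a₁ Efl logz χ) χ p) m)) := by
  have hγ' := theta13OfThm1CCMWZBChi_γ F N j γ εbg ε₀ ε₂₉ B₃ B₃' a₀ a₁ Efl logz χ
  refine (theta13OfThm1CCMWZBChi F N j γ εbg ε₀ ε₂₉ B₃ B₃' a₀ a₁ Efl logz χ).hcompBoth_of_betaBoxSignFree_chi χ (bl := bl) (β' := β')
    (by rw [theta13OfThm1CCMWZBChi_A₀]; exact A0OfThm1CC1_nonneg hB hB' ha₀ ha₁) (theta13OfThm1CCMWZBChi_p₀ F N j γ εbg ε₀ ε₂₉ B₃ B₃' a₀ a₁ Efl logz χ) (by rw [hγ']; exact hγ)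
    (by rw [theta13OfThm1CCMWZBChi_cR]; norm_num) (by rw [hγ']; exact hlow) (by rw [hγ']; exact hup) ?_ ?_
  · rw [hγ']; exact hl
  · rw [hγ']; exact hu

/-- **★★ʷ THE SAME FROM THE SIGN-FREE BOX OF THE HALF-WINDOW MEMBER `β₁₃(θ₁₅ᶜᶜᴹᵂᶻᴮ(j; ½; εbg))` ON `]0, γ]`** (§5 transfer `betaLowerH∕betaUpperH_theta13OfThm1CCMWZB_of_half_chi`).  These hypotheses are the
WINDOWED TWO-SIDED BOX WITH LETTERS — dag-n21-c's 3ʷ text with `0 ≤ b` replaced by the letter `−b·γ² ≤ 3`.  CONDITIONAL.  (node O P3 g48 §4ʷ at Z3.) [cite: Balaban1987RG1, (1.20)–(1.22) p.264, (0.20) p.256, §1 p.264; Balaban1988Convergent, (2.4)–(2.8) pp.255–256] -/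
theorem hcompBoth_theta13OfThm1CCMWZB_of_betaBoxSignFree_half_chi (hγ : γ ≤ 1 / 2) (hB : 0 ≤ B₃) (hB' : 0 ≤ B₃') (ha₀ : 0 ≤ a₀) (ha₁ : 0 ≤ a₁) {bl β' : ℝ}
    (hlow : BetaLowerH bl γ (betaOfRecord₁₃Chi F N (theta13OfThm1CCMWZBChi F N j (1 / 2) εbg ε₀ ε₂₉ B₃ B₃' a₀ a₁ Efl logz χ) χ))
    (hup : BetaUpperH β' γ (betaOfRecord₁₃Chi F N (theta13OfThm1CCMWZBChi F N j (1 / 2) εbg ε₀ ε₂₉ B₃ B₃' a₀ a₁ Efl logz χ) χ)) (hl : -bl * γ ^ 2 ≤ 3) (hu : β' * γ ^ 2 ≤ 3 / 4) :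
    (∀ (p : B12.RunParams) (n : ℕ), n ≤ p.K → Step.InInterval (theta13OfThm1CCMWZBChi F N j γ εbg ε₀ ε₂₉ B₃ B₃' a₀ a₁ Efl logz χ).γ n (gOfRecord₁₃Chi F N (theta13OfThm1CCMWZBChi F N j γ εbg ε₀ ε₂₉ B₃ B₃' a₀ a₁ Efl logz χ) χ p) → ∀ m, m < n →
      (theta13OfThm1CCMWZBChi F N j γ εbg ε₀ ε₂₉ B₃ B₃' a₀ a₁ Efl logz χ).s2.cR * epsOfRecord (theta13OfThm1CCMWZBChi F N j γ εbg ε₀ ε₂₉ B₃ B₃' a₀ a₁ Efl logz χ).ν (gOfRecord₁₃Chi F N (theta13OfThm1CCMWZBChi F N j γ εbg ε₀ ε₂₉ B₃ B₃' a₀ a₁ Efl logz χ) χ p) m ≤ 2 * ((theta13OfThm1CCMWZBChi F N j γ εbg ε₀ ε₂₉ B₃ B₃' a₀ a₁ Efl logz χ).s2.cR * epsOfRecord (theta13OfThm1CCMWZBChi F N j γ εbg ε₀ ε₂₉ B₃ B₃' a₀ a₁ Efl logz χ).ν (gOfRecord₁₃Chi F N (theta13OfThm1CCMWZBChi F N j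 γ εbg ε₀ ε₂₉ B₃ B₃' a₀ a₁ Efl logz χ) χ p) (m + 1))) ∧
    (∀ (p : B12.RunParams) (n : ℕ), n ≤ p.K → Step.InInterval (theta13OfThm1CCMWZBChi F N j γ εbg ε₀ ε₂₉ B₃ B₃' a₀ a₁ Efl logz χ).γ n (gOfRecord₁₃Chi F N (theta13OfThm1CCMWZBChi F N j γ εbg ε₀ ε₂₉ B₃ B₃' a₀ a₁ Efl logz χ) χ p) → ∀ m, m < n →
      (theta13OfThm1CCMWZBChi F N j γ εbg ε₀ ε₂₉ B₃ B₃' a₀ a₁ Efl logz χ).s2.cR * epsOfRecord (theta13OfThm1CCMWZBChi F N j γ εbg ε₀ ε₂₉ B₃ B₃' a₀ a₁ Efl logz χ).ν (gOfRecord₁₃Chi F N (theta13OfThm1CCMWZBChi F N j γ εbg ε₀ ε₂₉ B₃ B₃' a₀ a₁ Efl logz χ) χ p) (m + 1) ≤ 2 * ((theta13OfThm1CCMWZBChi F N j γ εbg ε₀ ε₂₉ B₃ B₃' a₀ a₁ Efl logz χ).s2.cR * epsOfRecord (theta13OfThm1CCMWZBChi F N j γ εbg ε₀ ε₂₉ B₃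 B₃' a₀ a₁ Efl logz χ).ν (gOfRecord₁₃Chi F N (theta13OfThm1CCMWZBChi F N j γ εbg ε₀ ε₂₉ B₃ B₃' a₀ a₁ Efl logz χ) χ p) m)) :=
  hcompBoth_theta13OfThm1CCMWZB_of_betaBoxSignFree_chi hγ hB hB' ha₀ ha₁ (betaLowerH_theta13OfThm1CCMWZB_of_half_chi hγ hlow) (betaUpperH_theta13OfThm1CCMWZB_of_half_chi hγ hup) hl hu

end SignFreeChi

/-! # PART Ax — the same letters at the RE-CENTRED witness `θᴬˣ := theta13OfThm1CCMWZBAx …` over `gOfRecord₁₃Ax θᴬˣ` ∕ `betaOfRecord₁₃Ax θᴬˣ` (each the χ row at `χ := chiFixed29Ax F N ν ε₂₉`) -/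

/-! ## §A·§0. The one window-blind face of `θ₁₅ᶜᶜᴹᵂᶻᴮ(j; γ; εbg)` A2ʷ's proofs read that Z3 does not already print: the large-field letters (`rfl`). The numerics faces
`theta13OfThm1CCMWZB_εreg ∕ _A₀ ∕ _p₀ ∕ _r ∕ _M₁ ∕ _cB ∕ _B ∕ _C ∕ _Mr ∕ _cR ∕ _βc ∕ _τ9_M ∕ _γ` are Z3's (`Record13NumericsOfThm1CCMWZB` §3), cited by name below. -/

section FacesZAx

variable (F : T4Family) (N : ℕ) [NeZero N] (j : ℕ) (γ εbg ε₀ ε₂₉ B₃ B₃' a₀ a₁ : ℝ) (Efl logz : B12.RunParams → ℕ → ℝ)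

/-- The large-field letters of record at `θ₁₅ᶜᶜᴹᵂᶻᴮ(j; γ; εbg)`: the family's constants with the window `γ` (re-centred witness; `rfl`; A1ʷ's `lfOfRecord₁₂_theta13OfThm1CCMW`, token-pass). [cite: Balaban1988Convergent, (2.28) p.259 (bookkeeping)] -/
theorem lfOfRecord₁₂_theta13OfThm1CCMWZBAx :
    lfOfRecord₁₂ F N (theta13OfThm1CCMWZBAx F N j γ εbg ε₀ ε₂₉ B₃ B₃' a₀ a₁ Efl logz).toStage12Params = { lfConstsOfFamily with γ := γ } := rfl

end FacesZAx

/-! ## §A·§3. The letters of the GAUGE road at `θ₁₅ᶜᶜᴹᵂᶻᴮ(j; γ; εbg)`, along every `γ`-windowed run, `γ ≤ ½` -/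

section FacesAx

variable {F : T4Family} {N : ℕ} [NeZero N] {j : ℕ} {γ εbg ε₀ ε₂₉ B₃ B₃' a₀ a₁ : ℝ} {Efl logz : B12.RunParams → ℕ → ℝ}

/-- RE-CENTRED EDITION (`θᴬˣ := theta13OfThm1CCMWZBAx …`, β-slot `chiFixed29Ax F N ν ε₂₉`; the χ row at that slot). **(hnum) AT `θ₁₅ᶜᶜᴹᵂᶻᴮ(j; γ; εbg)`** (`γ ≤ ½ < 1`): `0 < cR·ε_m ≤ a₁`, `B₃·cR·ε_m ≤ εreg = a₀` along every windowed run (13a's window lemma; thresholds window-blind).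
[cite: Balaban1988Convergent, (2.4) p.255, (2.12) p.256; Balaban1985Variational, Thm 1 (7)–(8) p.279] -/
theorem hnum_theta13OfThm1CCMWZBAx (hγ : γ ≤ 1 / 2) (hB : 0 ≤ B₃) (hB' : 0 ≤ B₃') (ha₀ : 0 < a₀) (ha₁ : 0 < a₁) :
     ∀ (p : B12.RunParams) (n : ℕ), n ≤ p.K → Step.InInterval (theta13OfThm1CCMWZBAx F N j γ εbg ε₀ ε₂₉ B₃ B₃' a₀ a₁ Efl logz).γ n (gOfRecord₁₃Ax F N (theta13OfThm1CCMWZBAx F N j γ εbg ε₀ ε₂₉ B₃ B₃' a₀ a₁ Efl logz) p) → ∀ m, m ≤ n →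
      0 < (theta13OfThm1CCMWZBAx F N j γ εbg ε₀ ε₂₉ B₃ B₃' a₀ a₁ Efl logz).s2.cR * epsOfRecord (theta13OfThm1CCMWZBAx F N j γ εbg ε₀ ε₂₉ B₃ B₃' a₀ a₁ Efl logz).ν (gOfRecord₁₃Ax F N (theta13OfThm1CCMWZBAx F N j γ εbg ε₀ ε₂₉ B₃ B₃' a₀ a₁ Efl logz) p) m ∧ (theta13OfThm1CCMWZBAx F N j γ εbg ε₀ ε₂₉ B₃ B₃' a₀ a₁ Efl logz).s2.cR * epsOfRecord (theta13OfThm1CCMWZBAx F N j γ εbg ε₀ ε₂₉ B₃ B₃' a₀ a₁ Efl logz).ν (gOfRecord₁₃Ax F N (theta13OfThm1CCMWZBAx F N j γ εbg ε₀ ε₂₉ B₃ B₃' a₀ a₁ Efl logz) p) m ≤ a₁ ∧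
        B₃ * ((theta13OfThm1CCMWZBAx F N j γ εbg ε₀ ε₂₉ B₃ B₃' a₀ a₁ Efl logz).s2.cR * epsOfRecord (theta13OfThm1CCMWZBAx F N j γ εbg ε₀ ε₂₉ B₃ B₃' a₀ a₁ Efl logz).ν (gOfRecord₁₃Ax F N (theta13OfThm1CCMWZBAx F N j γ εbg ε₀ ε₂₉ B₃ B₃' a₀ a₁ Efl logz) p) m) ≤ (theta13OfThm1CCMWZBAx F N j γ εbg ε₀ ε₂₉ B₃ B₃' a₀ a₁ Efl logz).ν.εreg :=
  hnum_theta13OfThm1CCMWZB_chi (χ := chiFixed29Ax F N (numerics7OfThm1CCM F.L j ε₀ B₃ B₃' a₀ a₁) ε₂₉) hγ hB hB' ha₀ ha₁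

/-- RE-CENTRED EDITION (`θᴬˣ := theta13OfThm1CCMWZBAx …`, β-slot `chiFixed29Ax F N ν ε₂₉`; the χ row at that slot). `θ₁₅ᶜᶜᴹᵂᶻᴮ(j; γ; εbg).ν.εreg ≤ a₀` (it IS `a₀`). [cite: Balaban1985Variational, Thm 1 (8) p.279 (bookkeeping)] -/
theorem εreg_le_theta13OfThm1CCMWZBAx : (theta13OfThm1CCMWZBAx F N j γ εbg ε₀ ε₂₉ B₃ B₃' a₀ a₁ Efl logz).ν.εreg ≤ a₀ :=
  εreg_le_theta13OfThm1CCMWZB_chi (χ := chiFixed29Ax F N (numerics7OfThm1CCM F.L j ε₀ B₃ B₃' a₀ a₁) ε₂₉)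

/-- RE-CENTRED EDITION (`θᴬˣ := theta13OfThm1CCMWZBAx …`, β-slot `chiFixed29Ax F N ν ε₂₉`; the χ row at that slot). **`0 ≤ cR·ε_m` AT `θ₁₅ᶜᶜᴹᵂᶻᴮ(j; γ; εbg)`** along every windowed run. [cite: Balaban1988Convergent, (2.4) p.255, (2.10) p.256 (bookkeeping)] -/
theorem hε0_theta13OfThm1CCMWZBAx (hγ : γ ≤ 1 / 2) (hB : 0 ≤ B₃) (hB' : 0 ≤ B₃') (ha₀ : 0 < a₀) (ha₁ : 0 < a₁) :
     ∀ (p : B12.RunParams) (n : ℕ), n ≤ p.K → Step.InInterval (theta13OfThm1CCMWZBAx F N j γ εbg ε₀ ε₂₉ B₃ B₃' a₀ a₁ Efl logz).γ n (gOfRecord₁₃Ax F N (theta13OfThm1CCMWZBAx F N j γ εbg ε₀ ε₂₉ B₃ B₃' a₀ a₁ Efl logz) p) → ∀ m, m ≤ n → 0 ≤ (theta13OfThm1CCMWZBAx F N j γ εbg ε₀ ε₂₉ B₃ B₃' a₀ a₁ Efl logz).s2.cR * epsOfRecord (theta13OfThm1CCMWZBAx F N j γ εbg ε₀ ε₂₉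 B₃ B₃' a₀ a₁ Efl logz).ν (gOfRecord₁₃Ax F N (theta13OfThm1CCMWZBAx F N j γ εbg ε₀ ε₂₉ B₃ B₃' a₀ a₁ Efl logz) p) m :=
  hε0_theta13OfThm1CCMWZB_chi (χ := chiFixed29Ax F N (numerics7OfThm1CCM F.L j ε₀ B₃ B₃' a₀ a₁) ε₂₉) hγ hB hB' ha₀ ha₁

/-- RE-CENTRED EDITION (`θᴬˣ := theta13OfThm1CCMWZBAx …`, β-slot `chiFixed29Ax F N ν ε₂₉`; the χ row at that slot). **THE WINDOW LETTERS AT `θ₁₅ᶜᶜᴹᵂᶻᴮ(j; γ; εbg)`** (`γ ≤ ½`): `0 < g_m`, `g_m² ≤ e⁻¹` along every windowed run. [cite: Balaban1987RG1, Thm 1 p.259; Balaban1988Convergent, (2.4) p.255 (bookkeeping)] -/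
theorem hg_theta13OfThm1CCMWZBAx (hγ : γ ≤ 1 / 2) :
     ∀ (p : B12.RunParams) (n : ℕ), n ≤ p.K → Step.InInterval (theta13OfThm1CCMWZBAx F N j γ εbg ε₀ ε₂₉ B₃ B₃' a₀ a₁ Efl logz).γ n (gOfRecord₁₃Ax F N (theta13OfThm1CCMWZBAx F N j γ εbg ε₀ ε₂₉ B₃ B₃' a₀ a₁ Efl logz) p) → ∀ m, m ≤ n → 0 < gOfRecord₁₃Ax F N (theta13OfThm1CCMWZBAx F N j γ εbg ε₀ ε₂₉ B₃ B₃' a₀ a₁ Efl logz) p m ∧ gOfRecord₁₃Ax F N (theta13OfThm1CCMWZBAx F N j γ εbg ε₀ ε₂₉ B₃ B₃' a₀ a₁ Efl logz) p m ^ 2 ≤ Real.exp (-1) :=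
  hg_theta13OfThm1CCMWZB_chi (χ := chiFixed29Ax F N (numerics7OfThm1CCM F.L j ε₀ B₃ B₃' a₀ a₁) ε₂₉) hγ

/-- RE-CENTRED EDITION (`θᴬˣ := theta13OfThm1CCMWZBAx …`, β-slot `chiFixed29Ax F N ν ε₂₉`; the χ row at that slot). **`p₀ ≤ q₀` AT `θ₁₅ᶜᶜᴹᵂᶻᴮ(j; γ; εbg)`** (`1 ≤ 2`). [cite: Balaban1988Convergent, (2.4) p.255, (2.28) p.259 (bookkeeping)] -/
theorem hpq_theta13OfThm1CCMWZBAx : (theta13OfThm1CCMWZBAx F N j γ εbg ε₀ ε₂₉ B₃ B₃' a₀ a₁ Efl logz).ν.p₀ ≤ (lfOfRecord₁₂ F N (theta13OfThm1CCMWZBAx F N j γ εbg ε₀ ε₂₉ B₃ B₃' a₀ a₁ Efl logz).toStage12Params).q₀ :=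
  hpq_theta13OfThm1CCMWZB_chi (χ := chiFixed29Ax F N (numerics7OfThm1CCM F.L j ε₀ B₃ B₃' a₀ a₁) ε₂₉)

/-- RE-CENTRED EDITION (`θᴬˣ := theta13OfThm1CCMWZBAx …`, β-slot `chiFixed29Ax F N ν ε₂₉`; the χ row at that slot). **`α₀(g_m) > 0` AT `θ₁₅ᶜᶜᴹᵂᶻᴮ(j; γ; εbg)`** along every windowed run (`C₀ = 1 > 0`, `0 < g_m ≤ γ ≤ ½ < 1`). [cite: Balaban1988Convergent, (2.28) p.259 (bookkeeping)] -/
theorem hα0_theta13OfThm1CCMWZBAx (hγ : γ ≤ 1 / 2) :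
    ∀ (p : B12.RunParams) (n : ℕ), n ≤ p.K → Step.InInterval (theta13OfThm1CCMWZBAx F N j γ εbg ε₀ ε₂₉ B₃ B₃' a₀ a₁ Efl logz).γ n (gOfRecord₁₃Ax F N (theta13OfThm1CCMWZBAx F N j γ εbg ε₀ ε₂₉ B₃ B₃' a₀ a₁ Efl logz) p) → ∀ m, m ≤ n →
      0 < (lfOfRecord₁₂ F N (theta13OfThm1CCMWZBAx F N j γ εbg ε₀ ε₂₉ B₃ B₃' a₀ a₁ Efl logz).toStage12Params).alpha0 (gOfRecord₁₃Ax F N (theta13OfThm1CCMWZBAx F N j γ εbg ε₀ ε₂₉ B₃ B₃' a₀ a₁ Efl logz) p m) :=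
  hα0_theta13OfThm1CCMWZB_chi (χ := chiFixed29Ax F N (numerics7OfThm1CCM F.L j ε₀ B₃ B₃' a₀ a₁) ε₂₉) hγ

/-- RE-CENTRED EDITION (`θᴬˣ := theta13OfThm1CCMWZBAx …`, β-slot `chiFixed29Ax F N ν ε₂₉`; the χ row at that slot). `0 ≤ B₃·cR·A₀` at `θ₁₅ᶜᶜᴹᵂᶻᴮ(j; γ; εbg)` (window-blind: A2's at `θ₁₅ᶜᶜᴹ(j)`). [cite: Balaban1988Convergent, (2.28) p.259 (bookkeeping)] -/
theorem mul_A0_nonneg_thm1CCMWZBAx (hB : 0 ≤ B₃) (hB' : 0 ≤ B₃') (ha₀ : 0 ≤ a₀) (ha₁ : 0 ≤ a₁) :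
    0 ≤ B₃ * (theta13OfThm1CCMWZBAx F N j γ εbg ε₀ ε₂₉ B₃ B₃' a₀ a₁ Efl logz).s2.cR * (theta13OfThm1CCMWZBAx F N j γ εbg ε₀ ε₂₉ B₃ B₃' a₀ a₁ Efl logz).ν.A₀ :=
  mul_A0_nonneg_thm1CCMWZB_chi (χ := chiFixed29Ax F N (numerics7OfThm1CCM F.L j ε₀ B₃ B₃' a₀ a₁) ε₂₉) hB hB' ha₀ ha₁

/-- RE-CENTRED EDITION (`θᴬˣ := theta13OfThm1CCMWZBAx …`, β-slot `chiFixed29Ax F N ν ε₂₉`; the χ row at that slot). The «C₀ sufficiently large» inequality of (2.34) at `θ₁₅ᶜᶜᴹᵂᶻᴮ(j; γ; εbg)`: `B₃·cR·A₀ᶜᶜ¹ ≤ (1 − β)·C₀` (window-blind). [cite: Balaban1988Convergent, (2.28) p.259, (2.34) p.261] -/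
theorem mul_A0_le_C₀_thm1CCMWZBAx (hB : 0 ≤ B₃) (hB' : 0 ≤ B₃') (ha₀ : 0 ≤ a₀) (ha₁ : 0 ≤ a₁) :
    B₃ * (theta13OfThm1CCMWZBAx F N j γ εbg ε₀ ε₂₉ B₃ B₃' a₀ a₁ Efl logz).s2.cR * (theta13OfThm1CCMWZBAx F N j γ εbg ε₀ ε₂₉ B₃ B₃' a₀ a₁ Efl logz).ν.A₀ ≤
      (1 - (theta13OfThm1CCMWZBAx F N j γ εbg ε₀ ε₂₉ B₃ B₃' a₀ a₁ Efl logz).s2.βc) * (lfOfRecord₁₂ F N (theta13OfThm1CCMWZBAx F N j γ εbg ε₀ ε₂₉ B₃ B₃' a₀ a₁ Efl logz).toStage12Params).C₀ :=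
  mul_A0_le_C₀_thm1CCMWZB_chi (χ := chiFixed29Ax F N (numerics7OfThm1CCM F.L j ε₀ B₃ B₃' a₀ a₁) ε₂₉) hB hB' ha₀ ha₁

/-- RE-CENTRED EDITION (`θᴬˣ := theta13OfThm1CCMWZBAx …`, β-slot `chiFixed29Ax F N ν ε₂₉`; the χ row at that slot). **(hBα) AT `θ₁₅ᶜᶜᴹᵂᶻᴮ(j; γ; εbg)`** (`bg_numerics_of_letters`: `p₀ = 1 ≤ q₀ = 2`, `B₃·A₀ᶜᶜ¹ ≤ ¾·C₀`, `g_m² ≤ e⁻¹`). [cite: Balaban1988Convergent, (2.4) p.255, (2.28) p.259, (2.34) p.261] -/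
theorem hBα_theta13OfThm1CCMWZBAx (hγ : γ ≤ 1 / 2) (hB : 0 ≤ B₃) (hB' : 0 ≤ B₃') (ha₀ : 0 ≤ a₀) (ha₁ : 0 ≤ a₁) :
     ∀ (p : B12.RunParams) (n : ℕ), n ≤ p.K → Step.InInterval (theta13OfThm1CCMWZBAx F N j γ εbg ε₀ ε₂₉ B₃ B₃' a₀ a₁ Efl logz).γ n (gOfRecord₁₃Ax F N (theta13OfThm1CCMWZBAx F N j γ εbg ε₀ ε₂₉ B₃ B₃' a₀ a₁ Efl logz) p) → ∀ m, 1 ≤ m → m ≤ n →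
      B₃ * ((theta13OfThm1CCMWZBAx F N j γ εbg ε₀ ε₂₉ B₃ B₃' a₀ a₁ Efl logz).s2.cR * epsOfRecord (theta13OfThm1CCMWZBAx F N j γ εbg ε₀ ε₂₉ B₃ B₃' a₀ a₁ Efl logz).ν (gOfRecord₁₃Ax F N (theta13OfThm1CCMWZBAx F N j γ εbg ε₀ ε₂₉ B₃ B₃' a₀ a₁ Efl logz) p) m) ≤ (1 - (theta13OfThm1CCMWZBAx F N j γ εbg ε₀ ε₂₉ B₃ B₃' a₀ a₁ Efl logz).s2.βc) * (lfOfRecord₁₂ F N (theta13OfThm1CCMWZBAx F N j γ εbg ε₀ ε₂₉ B₃ B₃' a₀ a₁ Efl logz).toStage12Params).alpha0 (gOfRecord₁₃Ax F N (theta13OfThm1CCMWZBAx F N j γ εbg ε₀ ε₂₉ B₃ B₃' a₀ a₁ Efl logz) p m) :=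
  hBα_theta13OfThm1CCMWZB_chi (χ := chiFixed29Ax F N (numerics7OfThm1CCM F.L j ε₀ B₃ B₃' a₀ a₁) ε₂₉) hγ hB hB' ha₀ ha₁

/-- RE-CENTRED EDITION (`θᴬˣ := theta13OfThm1CCMWZBAx …`, β-slot `chiFixed29Ax F N ν ε₂₉`; the χ row at that slot). **(C1) NESTED GRIDS AT `θ₁₅ᶜᶜᴹᵂᶻᴮ(j; γ; εbg)`**: `R_m = L·t_m` along every windowed run (`L ≥ 2`, `r = 1`, `log g_m⁻² > 1` in `]0, γ] ⊆ ]0, ½]`). [cite: Balaban1988Convergent, (2.5) p.255, p.257] -/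
theorem hC1_theta13OfThm1CCMWZBAx (hγ : γ ≤ 1 / 2) :
     ∀ (p : B12.RunParams) (n : ℕ), n ≤ p.K → Step.InInterval (theta13OfThm1CCMWZBAx F N j γ εbg ε₀ ε₂₉ B₃ B₃' a₀ a₁ Efl logz).γ n (gOfRecord₁₃Ax F N (theta13OfThm1CCMWZBAx F N j γ εbg ε₀ ε₂₉ B₃ B₃' a₀ a₁ Efl logz) p) → ∀ m, 1 ≤ m → m ≤ n →
      ∃ t : ℕ, 0 < t ∧ RkOfRecord (F.P p.K).L (theta13OfThm1CCMWZBAx F N j γ εbg ε₀ ε₂₉ B₃ B₃' a₀ a₁ Efl logz).ν.r (gOfRecord₁₃Ax F N (theta13OfThm1CCMWZBAx F N j γ εbg ε₀ ε₂₉ B₃ B₃' a₀ a₁ Efl logz) p m) = (F.P p.K).L * t :=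
  hC1_theta13OfThm1CCMWZB_chi (χ := chiFixed29Ax F N (numerics7OfThm1CCM F.L j ε₀ B₃ B₃' a₀ a₁) ε₂₉) hγ

/-- RE-CENTRED EDITION (`θᴬˣ := theta13OfThm1CCMWZBAx …`, β-slot `chiFixed29Ax F N ν ε₂₉`; the χ row at that slot). **(hcomp) AT `θ₁₅ᶜᶜᴹᵂᶻᴮ(j; γ; εbg)` from the MONOTONICITY of the windowed history** (`cR·ε_m ≤ 2·cR·ε_{m+1}`; `p₀ = 1`, `A₀ ≥ 0`, `g_{m+1} ≤ γ ≤ ½`).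
[cite: Balaban1988Convergent, (2.4) p.255, (2.7)–(2.8) pp.255–256; Balaban1987RG1, Thm 1 p.259] -/
theorem hcomp_theta13OfThm1CCMWZBAx_of_monotone (hγ : γ ≤ 1 / 2) (hB : 0 ≤ B₃) (hB' : 0 ≤ B₃') (ha₀ : 0 ≤ a₀) (ha₁ : 0 ≤ a₁)
    (hmono : ∀ (p : B12.RunParams) (n : ℕ), n ≤ p.K → Step.InInterval (theta13OfThm1CCMWZBAx F N j γ εbg ε₀ ε₂₉ B₃ B₃' a₀ a₁ Efl logz).γ n (gOfRecord₁₃Ax F N (theta13OfThm1CCMWZBAx F N j γ εbg ε₀ ε₂₉ B₃ B₃' a₀ a₁ Efl logz) p) → ∀ m, m < n →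
      gOfRecord₁₃Ax F N (theta13OfThm1CCMWZBAx F N j γ εbg ε₀ ε₂₉ B₃ B₃' a₀ a₁ Efl logz) p m ≤ gOfRecord₁₃Ax F N (theta13OfThm1CCMWZBAx F N j γ εbg ε₀ ε₂₉ B₃ B₃' a₀ a₁ Efl logz) p (m + 1)) :
     ∀ (p : B12.RunParams) (n : ℕ), n ≤ p.K → Step.InInterval (theta13OfThm1CCMWZBAx F N j γ εbg ε₀ ε₂₉ B₃ B₃' a₀ a₁ Efl logz).γ n (gOfRecord₁₃Ax F N (theta13OfThm1CCMWZBAx F N j γ εbg ε₀ ε₂₉ B₃ B₃' a₀ a₁ Efl logz) p) → ∀ m, m < n →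
      (theta13OfThm1CCMWZBAx F N j γ εbg ε₀ ε₂₉ B₃ B₃' a₀ a₁ Efl logz).s2.cR * epsOfRecord (theta13OfThm1CCMWZBAx F N j γ εbg ε₀ ε₂₉ B₃ B₃' a₀ a₁ Efl logz).ν (gOfRecord₁₃Ax F N (theta13OfThm1CCMWZBAx F N j γ εbg ε₀ ε₂₉ B₃ B₃' a₀ a₁ Efl logz) p) m ≤ 2 * ((theta13OfThm1CCMWZBAx F N j γ εbg ε₀ ε₂₉ B₃ B₃' a₀ a₁ Efl logz).s2.cR * epsOfRecord (theta13OfThm1CCMWZBAx F N j γ εbg ε₀ ε₂₉ B₃ B₃' a₀ a₁ Efl logz).ν (gOfRecord₁₃Ax F N (theta13OfThm1CCMWZBAx F N j γ εbg ε₀ ε₂₉ B₃ B₃' a₀ a₁ Efl logz) p) (m + 1)) :=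
  hcomp_theta13OfThm1CCMWZB_of_monotone_chi (χ := chiFixed29Ax F N (numerics7OfThm1CCM F.L j ε₀ B₃ B₃' a₀ a₁) ε₂₉) hγ hB hB' ha₀ ha₁ hmono

/-- RE-CENTRED EDITION (`θᴬˣ := theta13OfThm1CCMWZBAx …`, β-slot `chiFixed29Ax F N ν ε₂₉`; the χ row at that slot). `0 ≤ B₃′·cR·A₀` at `θ₁₅ᶜᶜᴹᵂᶻᴮ(j; γ; εbg)` (window-blind). [cite: Balaban1988Convergent, (2.28) p.259 (bookkeeping)] -/
theorem gauge_mul_A0_nonneg_thm1CCMWZBAx (hB : 0 ≤ B₃) (hB' : 0 ≤ B₃') (ha₀ : 0 ≤ a₀) (ha₁ : 0 ≤ a₁) :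
    0 ≤ B₃' * (theta13OfThm1CCMWZBAx F N j γ εbg ε₀ ε₂₉ B₃ B₃' a₀ a₁ Efl logz).s2.cR * (theta13OfThm1CCMWZBAx F N j γ εbg ε₀ ε₂₉ B₃ B₃' a₀ a₁ Efl logz).ν.A₀ :=
  gauge_mul_A0_nonneg_thm1CCMWZB_chi (χ := chiFixed29Ax F N (numerics7OfThm1CCM F.L j ε₀ B₃ B₃' a₀ a₁) ε₂₉) hB hB' ha₀ ha₁

/-- RE-CENTRED EDITION (`θᴬˣ := theta13OfThm1CCMWZBAx …`, β-slot `chiFixed29Ax F N ν ε₂₉`; the χ row at that slot). **«C₀ sufficiently large» FOR THE I-FAMILY GAUGES at `θ₁₅ᶜᶜᴹᵂᶻᴮ(j; γ; εbg)`**: `B₃′·cR·A₀ ≤ cB·C₀` (window-blind). [cite: Balaban1987RG1, (1.12) p.262; Balaban1988Convergent, (2.28) p.259] -/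
theorem gauge_mul_A0_le_cB_C₀_thm1CCMWZBAx (hB : 0 ≤ B₃) (hB' : 0 ≤ B₃') (ha₀ : 0 ≤ a₀) (ha₁ : 0 ≤ a₁) :
    B₃' * (theta13OfThm1CCMWZBAx F N j γ εbg ε₀ ε₂₉ B₃ B₃' a₀ a₁ Efl logz).s2.cR * (theta13OfThm1CCMWZBAx F N j γ εbg ε₀ ε₂₉ B₃ B₃' a₀ a₁ Efl logz).ν.A₀ ≤ (theta13OfThm1CCMWZBAx F N j γ εbg ε₀ ε₂₉ B₃ B₃' a₀ a₁ Efl logz).s2.cB * (lfOfRecord₁₂ F N (theta13OfThm1CCMWZBAx F N j γ εbg ε₀ ε₂₉ B₃ B₃' a₀ a₁ Efl logz).toStage12Params).C₀ :=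
  gauge_mul_A0_le_cB_C₀_thm1CCMWZB_chi (χ := chiFixed29Ax F N (numerics7OfThm1CCM F.L j ε₀ B₃ B₃' a₀ a₁) ε₂₉) hB hB' ha₀ ha₁

/-- RE-CENTRED EDITION (`θᴬˣ := theta13OfThm1CCMWZBAx …`, β-slot `chiFixed29Ax F N ν ε₂₉`; the χ row at that slot). **«C₀ sufficiently large» FOR THE MS-FAMILY GAUGES at `θ₁₅ᶜᶜᴹᵂᶻᴮ(j; γ; εbg)`**: `B₃′·cR·A₀ ≤ B·C·M_r·C₀` (window-blind). [cite: Balaban1988Convergent, (2.38) p.261, (2.28) p.259] -/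
theorem gauge_mul_A0_le_BCM_C₀_thm1CCMWZBAx (hB : 0 ≤ B₃) (hB' : 0 ≤ B₃') (ha₀ : 0 ≤ a₀) (ha₁ : 0 ≤ a₁) :
    B₃' * (theta13OfThm1CCMWZBAx F N j γ εbg ε₀ ε₂₉ B₃ B₃' a₀ a₁ Efl logz).s2.cR * (theta13OfThm1CCMWZBAx F N j γ εbg ε₀ ε₂₉ B₃ B₃' a₀ a₁ Efl logz).ν.A₀ ≤ (theta13OfThm1CCMWZBAx F N j γ εbg ε₀ ε₂₉ B₃ B₃' a₀ a₁ Efl logz).s2.B * (theta13OfThm1CCMWZBAx F N j γ εbg ε₀ ε₂₉ B₃ B₃' a₀ a₁ Efl logz).s2.C * (theta13OfThm1CCMWZBAx F N j γ εbg ε₀ ε₂₉ B₃ B₃' a₀ a₁ Efl logz).s2.Mr * (lfOfRecord₁₂ F N (theta13OfThm1CCMWZBAx F N j γ εbg ε₀ ε₂₉ B₃ B₃' a₀ a₁ Efl logz).toStage12Params).C₀ :=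
  gauge_mul_A0_le_BCM_C₀_thm1CCMWZB_chi (χ := chiFixed29Ax F N (numerics7OfThm1CCM F.L j ε₀ B₃ B₃' a₀ a₁) ε₂₉) hB hB' ha₀ ha₁

/-- RE-CENTRED EDITION (`θᴬˣ := theta13OfThm1CCMWZBAx …`, β-slot `chiFixed29Ax F N ν ε₂₉`; the χ row at that slot). **★ THE I-FAMILY RADIUS LETTER `htI` ALONG EVERY WINDOWED RUN AT `θ₁₅ᶜᶜᴹᵂᶻᴮ(j; γ; εbg)`**: `B₃′·(cR·ε_m) ≤ cB·α₀(g_m)`, `1 ≤ m ≤ n` (FILE 14 `gaugeLetter_of_numerics`).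
[cite: Balaban1987RG1, (1.12) p.262; Balaban1988Convergent, (2.4) p.255, (2.28) p.259] -/
theorem htI_theta13OfThm1CCMWZBAx (hγ : γ ≤ 1 / 2) (hB : 0 ≤ B₃) (hB' : 0 ≤ B₃') (ha₀ : 0 ≤ a₀) (ha₁ : 0 ≤ a₁) :
    ∀ (p : B12.RunParams) (n : ℕ), n ≤ p.K → Step.InInterval (theta13OfThm1CCMWZBAx F N j γ εbg ε₀ ε₂₉ B₃ B₃' a₀ a₁ Efl logz).γ n (gOfRecord₁₃Ax F N (theta13OfThm1CCMWZBAx F N j γ εbg ε₀ ε₂₉ B₃ B₃' a₀ a₁ Efl logz) p) → ∀ m, 1 ≤ m → m ≤ n →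
      B₃' * ((theta13OfThm1CCMWZBAx F N j γ εbg ε₀ ε₂₉ B₃ B₃' a₀ a₁ Efl logz).s2.cR * epsOfRecord (theta13OfThm1CCMWZBAx F N j γ εbg ε₀ ε₂₉ B₃ B₃' a₀ a₁ Efl logz).ν (gOfRecord₁₃Ax F N (theta13OfThm1CCMWZBAx F N j γ εbg ε₀ ε₂₉ B₃ B₃' a₀ a₁ Efl logz) p) m) ≤
        (theta13OfThm1CCMWZBAx F N j γ εbg ε₀ ε₂₉ B₃ B₃' a₀ a₁ Efl logz).s2.cB * (lfOfRecord₁₂ F N (theta13OfThm1CCMWZBAx F N j γ εbg ε₀ ε₂₉ B₃ B₃' a₀ a₁ Efl logz).toStage12Params).alpha0 (gOfRecord₁₃Ax F N (theta13OfThm1CCMWZBAx F N j γ εbg ε₀ ε₂₉ B₃ B₃' a₀ a₁ Efl logz) p m) :=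
  htI_theta13OfThm1CCMWZB_chi (χ := chiFixed29Ax F N (numerics7OfThm1CCM F.L j ε₀ B₃ B₃' a₀ a₁) ε₂₉) hγ hB hB' ha₀ ha₁

/-- RE-CENTRED EDITION (`θᴬˣ := theta13OfThm1CCMWZBAx …`, β-slot `chiFixed29Ax F N ν ε₂₉`; the χ row at that slot). **★ THE MS-FAMILY RADIUS LETTER `htMS` ALONG EVERY WINDOWED RUN AT `θ₁₅ᶜᶜᴹᵂᶻᴮ(j; γ; εbg)`**: `B₃′·(cR·ε_m) ≤ B·C·M_r·α₀(g_m)`, `1 ≤ m ≤ n`. [cite: Balaban1988Convergent, (2.38) p.261, (2.4) p.255, (2.28) p.259] -/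
theorem htMS_theta13OfThm1CCMWZBAx (hγ : γ ≤ 1 / 2) (hB : 0 ≤ B₃) (hB' : 0 ≤ B₃') (ha₀ : 0 ≤ a₀) (ha₁ : 0 ≤ a₁) :
    ∀ (p : B12.RunParams) (n : ℕ), n ≤ p.K → Step.InInterval (theta13OfThm1CCMWZBAx F N j γ εbg ε₀ ε₂₉ B₃ B₃' a₀ a₁ Efl logz).γ n (gOfRecord₁₃Ax F N (theta13OfThm1CCMWZBAx F N j γ εbg ε₀ ε₂₉ B₃ B₃' a₀ a₁ Efl logz) p) → ∀ m, 1 ≤ m → m ≤ n →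
      B₃' * ((theta13OfThm1CCMWZBAx F N j γ εbg ε₀ ε₂₉ B₃ B₃' a₀ a₁ Efl logz).s2.cR * epsOfRecord (theta13OfThm1CCMWZBAx F N j γ εbg ε₀ ε₂₉ B₃ B₃' a₀ a₁ Efl logz).ν (gOfRecord₁₃Ax F N (theta13OfThm1CCMWZBAx F N j γ εbg ε₀ ε₂₉ B₃ B₃' a₀ a₁ Efl logz) p) m) ≤
        (theta13OfThm1CCMWZBAx F N j γ εbg ε₀ ε₂₉ B₃ B₃' a₀ a₁ Efl logz).s2.B * (theta13OfThm1CCMWZBAx F N j γ εbg ε₀ ε₂₉ B₃ B₃' a₀ a₁ Efl logz).s2.C * (theta13OfThm1CCMWZBAx F N j γ εbg ε₀ ε₂₉ B₃ B₃' a₀ a₁ Efl logz).s2.Mr * (lfOfRecord₁₂ F N (theta13OfThm1CCMWZBAx F N j γ εbg ε₀ ε₂₉ B₃ B₃' a₀ a₁ Efl logz).toStage12Params).alpha0 (gOfRecord₁₃Ax F N (theta13OfThm1CCMWZBAx F N j γ εbg ε₀ ε₂₉ B₃ B₃' a₀ a₁ Efl logz) p m) :=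
  htMS_theta13OfThm1CCMWZB_chi (χ := chiFixed29Ax F N (numerics7OfThm1CCM F.L j ε₀ B₃ B₃' a₀ a₁) ε₂₉) hγ hB hB' ha₀ ha₁

end FacesAx

/-! ## §A·§4. The pins, the collar letter and the non-wrapping letter at `θ₁₅ᶜᶜᴹᵂᶻᴮ(j; γ; εbg)` — window-blind (A2's theorems re-read; `τ9.M = ν.M₁ = L^j` by `rfl` on both members) -/

section PinsAx

variable (F : T4Family) (N : ℕ) [NeZero N] (j : ℕ) (γ εbg ε₀ ε₂₉ B₃ B₃' a₀ a₁ : ℝ) (Efl logz : B12.RunParams → ℕ → ℝ)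

/-- RE-CENTRED EDITION (`θᴬˣ := theta13OfThm1CCMWZBAx …`, β-slot `chiFixed29Ax F N ν ε₂₉`; the χ row at that slot). `0 < θ₁₅ᶜᶜᴹᵂᶻᴮ(j; γ; εbg).τ9.M`. [cite: Balaban1989LargeFieldI, (2.1) p.182 (bookkeeping)] -/
theorem τ9_M_pos_theta13OfThm1CCMWZBAx : 0 < (theta13OfThm1CCMWZBAx F N j γ εbg ε₀ ε₂₉ B₃ B₃' a₀ a₁ Efl logz).τ9.M :=
  τ9_M_pos_theta13OfThm1CCMWZB_chi F N j γ εbg ε₀ ε₂₉ B₃ B₃' a₀ a₁ Efl logz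
    (chiFixed29Ax F N (numerics7OfThm1CCM F.L j ε₀ B₃ B₃' a₀ a₁) ε₂₉)

/-- RE-CENTRED EDITION (`θᴬˣ := theta13OfThm1CCMWZBAx …`, β-slot `chiFixed29Ax F N ν ε₂₉`; the χ row at that slot). `0 < θ₁₅ᶜᶜᴹᵂᶻᴮ(j; γ; εbg).ν.M₁` — the binder `0 < ν.M₁` of the step facts. [cite: Balaban1985RegularSpaces, (1.3)–(1.6) p.77 (bookkeeping)] -/
theorem M₁_pos_theta13OfThm1CCMWZBAx : 0 < (theta13OfThm1CCMWZBAx F N j γ εbg ε₀ ε₂₉ B₃ B₃' a₀ a₁ Efl logz).ν.M₁ :=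
  M₁_pos_theta13OfThm1CCMWZB_chi F N j γ εbg ε₀ ε₂₉ B₃ B₃' a₀ a₁ Efl logz
    (chiFixed29Ax F N (numerics7OfThm1CCM F.L j ε₀ B₃ B₃' a₀ a₁) ε₂₉)

/-- RE-CENTRED EDITION (`θᴬˣ := theta13OfThm1CCMWZBAx …`, β-slot `chiFixed29Ax F N ν ε₂₉`; the χ row at that slot). **THE PIN `hM`**: the cube letter is a power of `L` (`⟨j, rfl⟩`). [cite: Balaban1988Convergent, (2.18) p.257, p.245 (bookkeeping)] -/
theorem hM_theta13OfThm1CCMWZBAx : ∃ a : ℕ, (theta13OfThm1CCMWZBAx F N j γ εbg ε₀ ε₂₉ B₃ B₃' a₀ a₁ Efl logz).τ9.M = F.L ^ a :=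
  hM_theta13OfThm1CCMWZB_chi F N j γ εbg ε₀ ε₂₉ B₃ B₃' a₀ a₁ Efl logz
    (chiFixed29Ax F N (numerics7OfThm1CCM F.L j ε₀ B₃ B₃' a₀ a₁) ε₂₉)

/-- RE-CENTRED EDITION (`θᴬˣ := theta13OfThm1CCMWZBAx …`, β-slot `chiFixed29Ax F N ν ε₂₉`; the χ row at that slot). **THE PIN `hM₁`**: `M₁ ∣ M` (`L^j ∣ L^j`). [cite: Balaban1988Convergent, (2.13) p.256, (2.18) p.257 (bookkeeping)] -/
theorem hM₁_theta13OfThm1CCMWZBAx : (theta13OfThm1CCMWZBAx F N j γ εbg ε₀ ε₂₉ B₃ B₃' a₀ a₁ Efl logz).ν.M₁ ∣ (theta13OfThm1CCMWZBAx F N j γ εbg ε₀ ε₂₉ B₃ B₃' a₀ a₁ Efl logz).τ9.M :=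
  hM₁_theta13OfThm1CCMWZB_chi F N j γ εbg ε₀ ε₂₉ B₃ B₃' a₀ a₁ Efl logz
    (chiFixed29Ax F N (numerics7OfThm1CCM F.L j ε₀ B₃ B₃' a₀ a₁) ε₂₉)

variable {j} in
/-- RE-CENTRED EDITION (`θᴬˣ := theta13OfThm1CCMWZBAx …`, β-slot `chiFixed29Ax F N ν ε₂₉`; the χ row at that slot). **★ THE COLLAR LETTER OF THE R-ROAD AT `θ₁₅ᶜᶜᴹᵂᶻᴮ(j; γ; εbg)`**: `(11·4 + 3·L)·L ≤ ν.M₁` for every `j ≥ 3` (A2's, window-blind). [cite: Balaban1985RegularSpaces, Prop. 6 p.99, (1.130) p.99, (1.3)–(1.6) p.77; Balaban1985Variational, (144) p.300 (bookkeeping)] -/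
theorem collar_le_M₁_theta13OfThm1CCMWZBAx (hj : 3 ≤ j) : (11 * 4 + 3 * F.L) * F.L ≤ (theta13OfThm1CCMWZBAx F N j γ εbg ε₀ ε₂₉ B₃ B₃' a₀ a₁ Efl logz).ν.M₁ :=
  collar_le_M₁_theta13OfThm1CCMWZB_chi F N γ εbg ε₀ ε₂₉ B₃ B₃' a₀ a₁ Efl logz
    (chiFixed29Ax F N (numerics7OfThm1CCM F.L j ε₀ B₃ B₃' a₀ a₁) ε₂₉) hj

variable {j} in
/-- RE-CENTRED EDITION (`θᴬˣ := theta13OfThm1CCMWZBAx …`, β-slot `chiFixed29Ax F N ν ε₂₉`; the χ row at that slot). The collar letter in the `Setup.Params` letters of every torus of the family. [cite: Balaban1985RegularSpaces, Prop. 6 p.99 (bookkeeping)] -/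
theorem collar_le_M₁_theta13OfThm1CCMWZBAx' (hj : 3 ≤ j) (K : ℕ) :
    (11 * (F.P K).d + 3 * (F.P K).L) * (F.P K).L ≤ (theta13OfThm1CCMWZBAx F N j γ εbg ε₀ ε₂₉ B₃ B₃' a₀ a₁ Efl logz).ν.M₁ :=
  collar_le_M₁_theta13OfThm1CCMWZB'_chi F N γ εbg ε₀ ε₂₉ B₃ B₃' a₀ a₁ Efl logz
    (chiFixed29Ax F N (numerics7OfThm1CCM F.L j ε₀ B₃ B₃' a₀ a₁) ε₂₉) hj K

variable {j} in
/-- RE-CENTRED EDITION (`θᴬˣ := theta13OfThm1CCMWZBAx …`, β-slot `chiFixed29Ax F N ν ε₂₉`; the χ row at that slot). **★ NO WRAPPING AT `θ₁₅ᶜᶜᴹᵂᶻᴮ(j; γ; εbg)` UNDER `j + 1 ≤ F.m`** (A2's, window-blind). [cite: Balaban1987RG1, (0.1) p.251; Balaban1988Convergent, p.257 (bookkeeping)] -/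
theorem hsN_theta13OfThm1CCMWZBAx (hjm : j + 1 ≤ F.m) :
     ∀ (p : B12.RunParams) (n : ℕ), n ≤ p.K → ∀ n', 1 ≤ n' → n' ≤ n + 1 →
      ((B14.Eq213MaximalDomains.side (F.P p.K).L (theta13OfThm1CCMWZBAx F N j γ εbg ε₀ ε₂₉ B₃ B₃' a₀ a₁ Efl logz).τ9.M n' : ℕ) : ℤ) < (F.P p.K).sitesPerDir 0 :=
  hsN_theta13OfThm1CCMWZB_chi F N γ εbg ε₀ ε₂₉ B₃ B₃' a₀ a₁ Efl logz
    (chiFixed29Ax F N (numerics7OfThm1CCM F.L j ε₀ B₃ B₃' a₀ a₁) ε₂₉) hjm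

variable {j} in
/-- RE-CENTRED EDITION (`θᴬˣ := theta13OfThm1CCMWZBAx …`, β-slot `chiFixed29Ax F N ν ε₂₉`; the χ row at that slot). **THE CERTIFICATE OF (δ) AT `θ₁₅ᶜᶜᴹᵂᶻᴮ(j; γ; εbg)`** (window-blind): if `F.m ≤ j` the top [I]-cube wraps on every run. [cite: Balaban1987RG1, (0.1) p.251; Balaban1988Convergent, p.257 (bookkeeping certificate)] -/
theorem exists_wrap_theta13OfThm1CCMWZBAx_of_le (hmj : F.m ≤ j) (p : B12.RunParams) :
    ∃ n n', n ≤ p.K ∧ 1 ≤ n' ∧ n' ≤ n + 1 ∧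
      ¬ ((B14.Eq213MaximalDomains.side (F.P p.K).L (theta13OfThm1CCMWZBAx F N j γ εbg ε₀ ε₂₉ B₃ B₃' a₀ a₁ Efl logz).τ9.M n' : ℕ) : ℤ) < (F.P p.K).sitesPerDir 0 :=
  exists_wrap_theta13OfThm1CCMWZB_of_le_chi F N γ εbg ε₀ ε₂₉ B₃ B₃' a₀ a₁ Efl logz
    (chiFixed29Ax F N (numerics7OfThm1CCM F.L j ε₀ B₃ B₃' a₀ a₁) ε₂₉) hmj p

variable {j} in
/-- RE-CENTRED EDITION (`θᴬˣ := theta13OfThm1CCMWZBAx …`, β-slot `chiFixed29Ax F N ν ε₂₉`; the χ row at that slot). … so the universally quantified non-wrapping binder fails outright when `F.m ≤ j`. [cite: Balaban1987RG1, (0.1) p.251; Balaban1988Convergent, p.257 (bookkeeping certificate)] -/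
theorem not_hsN_theta13OfThm1CCMWZBAx_of_le (hmj : F.m ≤ j) (p : B12.RunParams) :
    ¬ ∀ n, n ≤ p.K → ∀ n', 1 ≤ n' → n' ≤ n + 1 →
      ((B14.Eq213MaximalDomains.side (F.P p.K).L (theta13OfThm1CCMWZBAx F N j γ εbg ε₀ ε₂₉ B₃ B₃' a₀ a₁ Efl logz).τ9.M n' : ℕ) : ℤ) < (F.P p.K).sitesPerDir 0 :=
  not_hsN_theta13OfThm1CCMWZB_of_le_chi F N γ εbg ε₀ ε₂₉ B₃ B₃' a₀ a₁ Efl logz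
    (chiFixed29Ax F N (numerics7OfThm1CCM F.L j ε₀ B₃ B₃' a₀ a₁) ε₂₉) hmj p

/-- RE-CENTRED EDITION (`θᴬˣ := theta13OfThm1CCMWZBAx …`, β-slot `chiFixed29Ax F N ν ε₂₉`; the χ row at that slot). **THE NON-WRAPPING BINDER AT `θ₁₅ᶜᶜᴹᵂᶻᴮ(j; γ; εbg)` IS EQUIVALENT TO `j + 1 ≤ F.m`** ((δ) is window-blind). [cite: Balaban1987RG1, (0.1) p.251; Balaban1988Convergent, p.257 (bookkeeping certificate)] -/
theorem hsN_theta13OfThm1CCMWZBAx_iff (p : B12.RunParams) :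
    (∀ n, n ≤ p.K → ∀ n', 1 ≤ n' → n' ≤ n + 1 →
      ((B14.Eq213MaximalDomains.side (F.P p.K).L (theta13OfThm1CCMWZBAx F N j γ εbg ε₀ ε₂₉ B₃ B₃' a₀ a₁ Efl logz).τ9.M n' : ℕ) : ℤ) < (F.P p.K).sitesPerDir 0) ↔ j + 1 ≤ F.m :=
  hsN_theta13OfThm1CCMWZB_iff_chi F N j γ εbg ε₀ ε₂₉ B₃ B₃' a₀ a₁ Efl logz
    (chiFixed29Ax F N (numerics7OfThm1CCM F.L j ε₀ B₃ B₃' a₀ a₁) ε₂₉) p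

end PinsAx

/-! ## §A·§5. ★★ THE β TRANSFER: on the box `]0, γ]`, `γ ≤ ½`, the β-functions of record of `θ₁₅ᶜᶜᴹᵂᶻᴮ(j; γ; εbg)` and of the half-window member `θ₁₅ᶜᶜᴹᵂᶻᴮ(j; ½; εbg)` coincide -/

section TransferAx

variable {F : T4Family} {N : ℕ} [NeZero N] {j : ℕ} {γ εbg ε₀ ε₂₉ B₃ B₃' a₀ a₁ : ℝ} {Efl logz : B12.RunParams → ℕ → ℝ}


/-- RE-CENTRED EDITION (`θᴬˣ := theta13OfThm1CCMWZBAx …`, β-slot `chiFixed29Ax F N ν ε₂₉`; the χ row at that slot). **★★ THE β TRANSFER**: for `γ ≤ ½` and every history `v ∈ ]0, γ]^{k+1}`, `β₁₃(θ₁₅ᶜᶜᴹᵂᶻᴮ(j; γ; εbg)) k v = β₁₃(θ₁₅ᶜᶜᴹ(j)) k v` — both witnesses carry the same Stage-7 numerics, (2.9)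
threshold, background radius, chart, basis and base histories, so [I] (1.20)–(1.22) on the merged term (1.6) give ONE function `β_merged`, and both box conventions read it on
`]0, γ] ⊆ ]0, ½]` (`betaOfMerged_of_mem`). [cite: Balaban1987RG1, (1.20)–(1.22) p.264, (1.6) p.261, (2.12)–(2.14) p.268] -/
theorem betaOfRecord₁₃_theta13OfThm1CCMWZBAx_eq_of_mem (hγ : γ ≤ 1 / 2) {k : ℕ} {v : Fin (k + 1) → ℝ} (hv : v ∈ Box γ k) :
    betaOfRecord₁₃Ax F N (theta13OfThm1CCMWZBAx F N j γ εbg ε₀ ε₂₉ B₃ B₃' a₀ a₁ Efl logz) k v = betaOfRecord₁₃Ax F N (theta13OfThm1CCMWZBAx F N j (1 / 2) εbg ε₀ ε₂₉ B₃ B₃' a₀ a₁ Efl logz) k v :=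
  betaOfRecord₁₃_theta13OfThm1CCMWZB_eq_of_mem_chi (χ := chiFixed29Ax F N (numerics7OfThm1CCM F.L j ε₀ B₃ B₃' a₀ a₁) ε₂₉) hγ hv

/-- RE-CENTRED EDITION (`θᴬˣ := theta13OfThm1CCMWZBAx …`, β-slot `chiFixed29Ax F N ν ε₂₉`; the χ row at that slot). **A LOWER β-BOUND OF THE HALF-WINDOW MEMBER ON `]0, γ]` IS ONE OF THE WINDOW EDITION** (`γ ≤ ½`). [cite: Balaban1987RG1, (1.20)–(1.22) p.264, §1 p.264; Balaban1989LargeFieldII, (1.4) p.357] -/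
theorem betaLowerH_theta13OfThm1CCMWZBAx_of_half (hγ : γ ≤ 1 / 2) {b : ℝ} (h : BetaLowerH b γ (betaOfRecord₁₃Ax F N (theta13OfThm1CCMWZBAx F N j (1 / 2) εbg ε₀ ε₂₉ B₃ B₃' a₀ a₁ Efl logz))) :
    BetaLowerH b γ (betaOfRecord₁₃Ax F N (theta13OfThm1CCMWZBAx F N j γ εbg ε₀ ε₂₉ B₃ B₃' a₀ a₁ Efl logz)) :=
  betaLowerH_theta13OfThm1CCMWZB_of_half_chi (χ := chiFixed29Ax F N (numerics7OfThm1CCM F.L j ε₀ B₃ B₃' a₀ a₁) ε₂₉) hγ h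

/-- RE-CENTRED EDITION (`θᴬˣ := theta13OfThm1CCMWZBAx …`, β-slot `chiFixed29Ax F N ν ε₂₉`; the χ row at that slot). **AN UPPER β-BOUND OF THE HALF-WINDOW MEMBER ON `]0, γ]` IS ONE OF THE WINDOW EDITION** (`γ ≤ ½`). [cite: Balaban1987RG1, (1.20)–(1.22) p.264, §1 p.264 («uniformly bounded»)] -/
theorem betaUpperH_theta13OfThm1CCMWZBAx_of_half (hγ : γ ≤ 1 / 2) {β' : ℝ} (h : BetaUpperH β' γ (betaOfRecord₁₃Ax F N (theta13OfThm1CCMWZBAx F N j (1 / 2) εbg ε₀ ε₂₉ B₃ B₃' a₀ a₁ Efl logz))) :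
    BetaUpperH β' γ (betaOfRecord₁₃Ax F N (theta13OfThm1CCMWZBAx F N j γ εbg ε₀ ε₂₉ B₃ B₃' a₀ a₁ Efl logz)) :=
  betaUpperH_theta13OfThm1CCMWZB_of_half_chi (χ := chiFixed29Ax F N (numerics7OfThm1CCM F.L j ε₀ B₃ B₃' a₀ a₁) ε₂₉) hγ h

/-- RE-CENTRED EDITION (`θᴬˣ := theta13OfThm1CCMWZBAx …`, β-slot `chiFixed29Ax F N ν ε₂₉`; the χ row at that slot). … and conversely (the transfer is an equality on the box). [cite: Balaban1987RG1, (1.20)–(1.22) p.264 (bookkeeping)] -/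
theorem betaLowerH_half_of_theta13OfThm1CCMWZBAx (hγ : γ ≤ 1 / 2) {b : ℝ} (h : BetaLowerH b γ (betaOfRecord₁₃Ax F N (theta13OfThm1CCMWZBAx F N j γ εbg ε₀ ε₂₉ B₃ B₃' a₀ a₁ Efl logz))) :
    BetaLowerH b γ (betaOfRecord₁₃Ax F N (theta13OfThm1CCMWZBAx F N j (1 / 2) εbg ε₀ ε₂₉ B₃ B₃' a₀ a₁ Efl logz)) :=
  betaLowerH_half_of_theta13OfThm1CCMWZB_chi (χ := chiFixed29Ax F N (numerics7OfThm1CCM F.L j ε₀ B₃ B₃' a₀ a₁) ε₂₉) hγ h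

/-- RE-CENTRED EDITION (`θᴬˣ := theta13OfThm1CCMWZBAx …`, β-slot `chiFixed29Ax F N ν ε₂₉`; the χ row at that slot). … and conversely for the upper bound. [cite: Balaban1987RG1, (1.20)–(1.22) p.264 (bookkeeping)] -/
theorem betaUpperH_half_of_theta13OfThm1CCMWZBAx (hγ : γ ≤ 1 / 2) {β' : ℝ} (h : BetaUpperH β' γ (betaOfRecord₁₃Ax F N (theta13OfThm1CCMWZBAx F N j γ εbg ε₀ ε₂₉ B₃ B₃' a₀ a₁ Efl logz))) :
    BetaUpperH β' γ (betaOfRecord₁₃Ax F N (theta13OfThm1CCMWZBAx F N j (1 / 2) εbg ε₀ ε₂₉ B₃ B₃' a₀ a₁ Efl logz)) :=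
  betaUpperH_half_of_theta13OfThm1CCMWZB_chi (χ := chiFixed29Ax F N (numerics7OfThm1CCM F.L j ε₀ B₃ B₃' a₀ a₁) ε₂₉) hγ h

end TransferAx

/-! ## §A·§6. The two history clauses at `θ₁₅ᶜᶜᴹᵂᶻᴮ(j; γ; εbg)` from the β-box on `]0, γ]` (13e ∕ 14d are θ-generic), and ★ from the β-box of the half-window member on `]0, γ]` -/

section HistoryAx

variable {F : T4Family} {N : ℕ} [NeZero N] {j : ℕ} {γ εbg ε₀ ε₂₉ B₃ B₃' a₀ a₁ : ℝ} {Efl logz : B12.RunParams → ℕ → ℝ}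

/-- RE-CENTRED EDITION (`θᴬˣ := theta13OfThm1CCMWZBAx …`, β-slot `chiFixed29Ax F N ν ε₂₉`; the χ row at that slot). **(hmono) AT `θ₁₅ᶜᶜᴹᵂᶻᴮ(j; γ; εbg)` from `BetaLowerH b γ β₁₃(θ₁₅ᶜᶜᴹᵂᶻᴮ(j; γ; εbg))`, `0 ≤ b`**. [cite: Balaban1987RG1, (0.20) p.256, §1 p.264; Balaban1988Convergent, (2.6) p.255] -/
theorem hmono_theta13OfThm1CCMWZBAx_of_betaLowerH {b : ℝ} (hb : 0 ≤ b) (hlow : BetaLowerH b γ (betaOfRecord₁₃Ax F N (theta13OfThm1CCMWZBAx F N j γ εbg ε₀ ε₂₉ B₃ B₃' a₀ a₁ Efl logz))) :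
    ∀ (p : B12.RunParams) (n : ℕ), n ≤ p.K → Step.InInterval (theta13OfThm1CCMWZBAx F N j γ εbg ε₀ ε₂₉ B₃ B₃' a₀ a₁ Efl logz).γ n (gOfRecord₁₃Ax F N (theta13OfThm1CCMWZBAx F N j γ εbg ε₀ ε₂₉ B₃ B₃' a₀ a₁ Efl logz) p) → ∀ m, m < n →
      gOfRecord₁₃Ax F N (theta13OfThm1CCMWZBAx F N j γ εbg ε₀ ε₂₉ B₃ B₃' a₀ a₁ Efl logz) p m ≤ gOfRecord₁₃Ax F N (theta13OfThm1CCMWZBAx F N j γ εbg ε₀ ε₂₉ B₃ B₃' a₀ a₁ Efl logz) p (m + 1) :=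
  hmono_theta13OfThm1CCMWZB_of_betaLowerH_chi (χ := chiFixed29Ax F N (numerics7OfThm1CCM F.L j ε₀ B₃ B₃' a₀ a₁) ε₂₉) hb hlow

/-- RE-CENTRED EDITION (`θᴬˣ := theta13OfThm1CCMWZBAx …`, β-slot `chiFixed29Ax F N ν ε₂₉`; the χ row at that slot). **(hcomp) AT `θ₁₅ᶜᶜᴹᵂᶻᴮ(j; γ; εbg)` FROM THE β-SIGN LEAF** on `]0, γ]`, `γ ≤ ½`. [cite: Balaban1988Convergent, (2.4) p.255, (2.6)–(2.8) pp.255–256; Balaban1987RG1, (0.20) p.256, §1 p.264] -/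
theorem hcomp_theta13OfThm1CCMWZBAx_of_betaLowerH (hγ : γ ≤ 1 / 2) (hB : 0 ≤ B₃) (hB' : 0 ≤ B₃') (ha₀ : 0 ≤ a₀) (ha₁ : 0 ≤ a₁)
    {b : ℝ} (hb : 0 ≤ b) (hlow : BetaLowerH b γ (betaOfRecord₁₃Ax F N (theta13OfThm1CCMWZBAx F N j γ εbg ε₀ ε₂₉ B₃ B₃' a₀ a₁ Efl logz))) :
    ∀ (p : B12.RunParams) (n : ℕ), n ≤ p.K → Step.InInterval (theta13OfThm1CCMWZBAx F N j γ εbg ε₀ ε₂₉ B₃ B₃' a₀ a₁ Efl logz).γ n (gOfRecord₁₃Ax F N (theta13OfThm1CCMWZBAx F N j γ εbg ε₀ ε₂₉ B₃ B₃' a₀ a₁ Efl logz) p) → ∀ m, m < n →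
      (theta13OfThm1CCMWZBAx F N j γ εbg ε₀ ε₂₉ B₃ B₃' a₀ a₁ Efl logz).s2.cR * epsOfRecord (theta13OfThm1CCMWZBAx F N j γ εbg ε₀ ε₂₉ B₃ B₃' a₀ a₁ Efl logz).ν (gOfRecord₁₃Ax F N (theta13OfThm1CCMWZBAx F N j γ εbg ε₀ ε₂₉ B₃ B₃' a₀ a₁ Efl logz) p) m ≤ 2 * ((theta13OfThm1CCMWZBAx F N j γ εbg ε₀ ε₂₉ B₃ B₃' a₀ a₁ Efl logz).s2.cR * epsOfRecord (theta13OfThm1CCMWZBAx F N j γ εbg ε₀ ε₂₉ B₃ B₃' a₀ a₁ Efl logz).ν (gOfRecord₁₃Ax F N (theta13OfThm1CCMWZBAx F N j γ εbg ε₀ ε₂₉ B₃ B₃' a₀ a₁ Efl logz) p) (m + 1)) :=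
  hcomp_theta13OfThm1CCMWZB_of_betaLowerH_chi (χ := chiFixed29Ax F N (numerics7OfThm1CCM F.L j ε₀ B₃ B₃' a₀ a₁) ε₂₉) hγ hB hB' ha₀ ha₁ hb hlow

/-- RE-CENTRED EDITION (`θᴬˣ := theta13OfThm1CCMWZBAx …`, β-slot `chiFixed29Ax F N ν ε₂₉`; the χ row at that slot). **★★ THE REVERSE COMPARABILITY CLAUSE AT `θ₁₅ᶜᶜᴹᵂᶻᴮ(j; γ; εbg)`** (`γ ≤ ½ ≤ 1`, `cR = 1`, `A₀ = A₀ᶜᶜ¹ ≥ 0`) from the β-box on `]0, γ]` with `0 ≤ b` and the 14d letter `β′·γ² ≤ ¾`.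
CONDITIONAL on the displayed β-box; nothing of Bałaban asserted. [cite: Balaban1988Convergent, (2.4) p.255, (2.6)–(2.8) pp.255–256; Balaban1987RG1, (0.20) p.256, §1 p.264; Balaban1985Variational, Thm 1 p.279] -/
theorem hcompRev_theta13OfThm1CCMWZBAx_of_betaBox (hγ : γ ≤ 1 / 2) (hB : 0 ≤ B₃) (hB' : 0 ≤ B₃') (ha₀ : 0 ≤ a₀) (ha₁ : 0 ≤ a₁)
    {b β' : ℝ} (hb : 0 ≤ b) (hlow : BetaLowerH b γ (betaOfRecord₁₃Ax F N (theta13OfThm1CCMWZBAx F N j γ εbg ε₀ ε₂₉ B₃ B₃' a₀ a₁ Efl logz)))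
    (hup : BetaUpperH β' γ (betaOfRecord₁₃Ax F N (theta13OfThm1CCMWZBAx F N j γ εbg ε₀ ε₂₉ B₃ B₃' a₀ a₁ Efl logz))) (hletter : β' * γ ^ 2 ≤ 3 / 4) :
    ∀ (p : B12.RunParams) (n : ℕ), n ≤ p.K → Step.InInterval (theta13OfThm1CCMWZBAx F N j γ εbg ε₀ ε₂₉ B₃ B₃' a₀ a₁ Efl logz).γ n (gOfRecord₁₃Ax F N (theta13OfThm1CCMWZBAx F N j γ εbg ε₀ ε₂₉ B₃ B₃' a₀ a₁ Efl logz) p) → ∀ m, m < n →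
      (theta13OfThm1CCMWZBAx F N j γ εbg ε₀ ε₂₉ B₃ B₃' a₀ a₁ Efl logz).s2.cR * epsOfRecord (theta13OfThm1CCMWZBAx F N j γ εbg ε₀ ε₂₉ B₃ B₃' a₀ a₁ Efl logz).ν (gOfRecord₁₃Ax F N (theta13OfThm1CCMWZBAx F N j γ εbg ε₀ ε₂₉ B₃ B₃' a₀ a₁ Efl logz) p) (m + 1) ≤ 2 * ((theta13OfThm1CCMWZBAx F N j γ εbg ε₀ ε₂₉ B₃ B₃' a₀ a₁ Efl logz).s2.cR * epsOfRecord (theta13OfThm1CCMWZBAx F N j γ εbg ε₀ ε₂₉ B₃ B₃' a₀ a₁ Efl logz).ν (gOfRecord₁₃Ax F N (theta13OfThm1CCMWZBAx F N j γ εbg ε₀ ε₂₉ B₃ B₃' a₀ a₁ Efl logz) p) m) :=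
  hcompRev_theta13OfThm1CCMWZB_of_betaBox_chi (χ := chiFixed29Ax F N (numerics7OfThm1CCM F.L j ε₀ B₃ B₃' a₀ a₁) ε₂₉) hγ hB hB' ha₀ ha₁ hb hlow hup hletter

/-- RE-CENTRED EDITION (`θᴬˣ := theta13OfThm1CCMWZBAx …`, β-slot `chiFixed29Ax F N ν ε₂₉`; the χ row at that slot). **★★ (hmono) AT `θ₁₅ᶜᶜᴹᵂᶻᴮ(j; γ; εbg)` FROM THE β-SIGN OF THE HALF-WINDOW MEMBER ON `]0, γ]`** (§5 transfer, `γ ≤ ½`). [cite: Balaban1987RG1, (0.20) p.256, (1.20)–(1.22) p.264; Balaban1989LargeFieldII, (1.4) p.357] -/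
theorem hmono_theta13OfThm1CCMWZBAx_of_betaLowerH_half (hγ : γ ≤ 1 / 2) {b : ℝ} (hb : 0 ≤ b)
    (hlow : BetaLowerH b γ (betaOfRecord₁₃Ax F N (theta13OfThm1CCMWZBAx F N j (1 / 2) εbg ε₀ ε₂₉ B₃ B₃' a₀ a₁ Efl logz))) :
    ∀ (p : B12.RunParams) (n : ℕ), n ≤ p.K → Step.InInterval (theta13OfThm1CCMWZBAx F N j γ εbg ε₀ ε₂₉ B₃ B₃' a₀ a₁ Efl logz).γ n (gOfRecord₁₃Ax F N (theta13OfThm1CCMWZBAx F N j γ εbg ε₀ ε₂₉ B₃ B₃' a₀ a₁ Efl logz) p) → ∀ m, m < n →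
      gOfRecord₁₃Ax F N (theta13OfThm1CCMWZBAx F N j γ εbg ε₀ ε₂₉ B₃ B₃' a₀ a₁ Efl logz) p m ≤ gOfRecord₁₃Ax F N (theta13OfThm1CCMWZBAx F N j γ εbg ε₀ ε₂₉ B₃ B₃' a₀ a₁ Efl logz) p (m + 1) :=
  hmono_theta13OfThm1CCMWZB_of_betaLowerH_half_chi (χ := chiFixed29Ax F N (numerics7OfThm1CCM F.L j ε₀ B₃ B₃' a₀ a₁) ε₂₉) hγ hb hlow

/-- RE-CENTRED EDITION (`θᴬˣ := theta13OfThm1CCMWZBAx …`, β-slot `chiFixed29Ax F N ν ε₂₉`; the χ row at that slot). **★★ THE REVERSE COMPARABILITY CLAUSE AT `θ₁₅ᶜᶜᴹᵂᶻᴮ(j; γ; εbg)` FROM THE β-BOX OF THE HALF-WINDOW MEMBER ON `]0, γ]`** (`γ ≤ ½`, `0 ≤ b`, `β′·γ² ≤ ¾`; §5 transfer ∘ 14d).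
[cite: Balaban1988Convergent, (2.6)–(2.8) pp.255–256; Balaban1987RG1, (0.20) p.256, (1.20)–(1.22) p.264, §1 p.264] -/
theorem hcompRev_theta13OfThm1CCMWZBAx_of_betaBox_half (hγ : γ ≤ 1 / 2) (hB : 0 ≤ B₃) (hB' : 0 ≤ B₃') (ha₀ : 0 ≤ a₀) (ha₁ : 0 ≤ a₁)
    {b β' : ℝ} (hb : 0 ≤ b) (hlow : BetaLowerH b γ (betaOfRecord₁₃Ax F N (theta13OfThm1CCMWZBAx F N j (1 / 2) εbg ε₀ ε₂₉ B₃ B₃' a₀ a₁ Efl logz)))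
    (hup : BetaUpperH β' γ (betaOfRecord₁₃Ax F N (theta13OfThm1CCMWZBAx F N j (1 / 2) εbg ε₀ ε₂₉ B₃ B₃' a₀ a₁ Efl logz))) (hletter : β' * γ ^ 2 ≤ 3 / 4) :
    ∀ (p : B12.RunParams) (n : ℕ), n ≤ p.K → Step.InInterval (theta13OfThm1CCMWZBAx F N j γ εbg ε₀ ε₂₉ B₃ B₃' a₀ a₁ Efl logz).γ n (gOfRecord₁₃Ax F N (theta13OfThm1CCMWZBAx F N j γ εbg ε₀ ε₂₉ B₃ B₃' a₀ a₁ Efl logz) p) → ∀ m, m < n →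
      (theta13OfThm1CCMWZBAx F N j γ εbg ε₀ ε₂₉ B₃ B₃' a₀ a₁ Efl logz).s2.cR * epsOfRecord (theta13OfThm1CCMWZBAx F N j γ εbg ε₀ ε₂₉ B₃ B₃' a₀ a₁ Efl logz).ν (gOfRecord₁₃Ax F N (theta13OfThm1CCMWZBAx F N j γ εbg ε₀ ε₂₉ B₃ B₃' a₀ a₁ Efl logz) p) (m + 1) ≤ 2 * ((theta13OfThm1CCMWZBAx F N j γ εbg ε₀ ε₂₉ B₃ B₃' a₀ a₁ Efl logz).s2.cR * epsOfRecord (theta13OfThm1CCMWZBAx F N j γ εbg ε₀ ε₂₉ B₃ B₃' a₀ a₁ Efl logz).ν (gOfRecord₁₃Ax F N (theta13OfThm1CCMWZBAx F N j γ εbg ε₀ ε₂₉ B₃ B₃' a₀ a₁ Efl logz) p) m) :=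
  hcompRev_theta13OfThm1CCMWZB_of_betaBox_half_chi (χ := chiFixed29Ax F N (numerics7OfThm1CCM F.L j ε₀ B₃ B₃' a₀ a₁) ε₂₉) hγ hB hB' ha₀ ha₁ hb hlow hup hletter

end HistoryAx

/-! ## §A·§6′. ★ The SIGN-FREE pair at `θ₁₅ᶜᶜᴹᵂᶻᴮ(j; γ; εbg)` (node O P3 g48 ∕ dag-n21-c `Record13SignFreeComparabilityOfBetaBox` §4ʷ, token-pass; §3 there is θ-generic): (hcomp) ∧ (hcompRev) from a two-sided box `bₗ ≤ β ≤ β′` of ANY sign -/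

section SignFreeAx

variable {F : T4Family} {N : ℕ} [NeZero N] {j : ℕ} {γ εbg ε₀ ε₂₉ B₃ B₃' a₀ a₁ : ℝ} {Efl logz : B12.RunParams → ℕ → ℝ}

/-- RE-CENTRED EDITION (`θᴬˣ := theta13OfThm1CCMWZBAx …`, β-slot `chiFixed29Ax F N ν ε₂₉`; the χ row at that slot). **★ʷ (hcomp) ∧ (hcompRev) AT `θ₁₅ᶜᶜᴹᵂᶻᴮ(j; γ; εbg)` FROM THE SIGN-FREE β-BOX OF ITS OWN β-FUNCTIONS ON `]0, γ]`** (`γ ≤ ½`; `bₗ`, `β′` of any sign with `−bₗ·γ² ≤ 3`, `β′·γ² ≤ ¾`; weak signs of the class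
constants) — §3 at `θ := θ₁₅ᶜᶜᴹᵂᶻᴮ(j; γ; εbg)`.  The sign-free twin of §6 (node O P3 g48's observation, tree file `Record13SignFreeComparabilityOfBetaBox` §4ʷ, token-pass).  CONDITIONAL on the displayed box.  (node O P3 g48 §4ʷ at Z3.) [cite: Balaban1988Convergent, (2.4) p.255, (2.6)–(2.8) pp.255–256; Balaban1987RG1, (0.20) p.256, §1 p.264] -/
theorem hcompBoth_theta13OfThm1CCMWZBAx_of_betaBoxSignFree (hγ : γ ≤ 1 / 2) (hB : 0 ≤ B₃) (hB' : 0 ≤ B₃') (ha₀ : 0 ≤ a₀) (ha₁ : 0 ≤ a₁) {bl β' : ℝ}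
    (hlow : BetaLowerH bl γ (betaOfRecord₁₃Ax F N (theta13OfThm1CCMWZBAx F N j γ εbg ε₀ ε₂₉ B₃ B₃' a₀ a₁ Efl logz)))
    (hup : BetaUpperH β' γ (betaOfRecord₁₃Ax F N (theta13OfThm1CCMWZBAx F N j γ εbg ε₀ ε₂₉ B₃ B₃' a₀ a₁ Efl logz))) (hl : -bl * γ ^ 2 ≤ 3) (hu : β' * γ ^ 2 ≤ 3 / 4) :
    (∀ (p : B12.RunParams) (n : ℕ), n ≤ p.K → Step.InInterval (theta13OfThm1CCMWZBAx F N j γ εbg ε₀ ε₂₉ B₃ B₃' a₀ a₁ Efl logz).γ n (gOfRecord₁₃Ax F N (theta13OfThm1CCMWZBAx F N j γ εbg ε₀ ε₂₉ B₃ B₃' a₀ a₁ Efl logz) p) → ∀ m, m < n →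
      (theta13OfThm1CCMWZBAx F N j γ εbg ε₀ ε₂₉ B₃ B₃' a₀ a₁ Efl logz).s2.cR * epsOfRecord (theta13OfThm1CCMWZBAx F N j γ εbg ε₀ ε₂₉ B₃ B₃' a₀ a₁ Efl logz).ν (gOfRecord₁₃Ax F N (theta13OfThm1CCMWZBAx F N j γ εbg ε₀ ε₂₉ B₃ B₃' a₀ a₁ Efl logz) p) m ≤ 2 * ((theta13OfThm1CCMWZBAx F N j γ εbg ε₀ ε₂₉ B₃ B₃' a₀ a₁ Efl logz).s2.cR * epsOfRecord (theta13OfThm1CCMWZBAx F N j γ εbg ε₀ ε₂₉ B₃ B₃' a₀ a₁ Efl logz).ν (gOfRecord₁₃Ax F N (theta13OfThm1CCMWZBAx F N j γ εbg ε₀ ε₂₉ B₃ B₃' a₀ a₁ Efl logz) p) (m + 1))) ∧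
    (∀ (p : B12.RunParams) (n : ℕ), n ≤ p.K → Step.InInterval (theta13OfThm1CCMWZBAx F N j γ εbg ε₀ ε₂₉ B₃ B₃' a₀ a₁ Efl logz).γ n (gOfRecord₁₃Ax F N (theta13OfThm1CCMWZBAx F N j γ εbg ε₀ ε₂₉ B₃ B₃' a₀ a₁ Efl logz) p) → ∀ m, m < n →
      (theta13OfThm1CCMWZBAx F N j γ εbg ε₀ ε₂₉ B₃ B₃' a₀ a₁ Efl logz).s2.cR * epsOfRecord (theta13OfThm1CCMWZBAx F N j γ εbg ε₀ ε₂₉ B₃ B₃' a₀ a₁ Efl logz).ν (gOfRecord₁₃Ax F N (theta13OfThm1CCMWZBAx F N j γ εbg ε₀ ε₂₉ B₃ B₃' a₀ a₁ Efl logz) p) (m + 1) ≤ 2 * ((theta13OfThm1CCMWZBAx F N j γ εbg ε₀ ε₂₉ B₃ B₃' a₀ a₁ Efl logz).s2.cR * epsOfRecord (theta13OfThm1CCMWZBAx F N j γ εbg ε₀ ε₂₉ B₃ B₃' a₀ a₁ Efl logz).ν (gOfRecord₁₃Ax F N (theta13OfThm1CCMWZBAx F N j γ εbg ε₀ ε₂₉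 B₃ B₃' a₀ a₁ Efl logz) p) m)) :=
  hcompBoth_theta13OfThm1CCMWZB_of_betaBoxSignFree_chi (χ := chiFixed29Ax F N (numerics7OfThm1CCM F.L j ε₀ B₃ B₃' a₀ a₁) ε₂₉) hγ hB hB' ha₀ ha₁ hlow hup hl hu

/-- RE-CENTRED EDITION (`θᴬˣ := theta13OfThm1CCMWZBAx …`, β-slot `chiFixed29Ax F N ν ε₂₉`; the χ row at that slot). **★★ʷ THE SAME FROM THE SIGN-FREE BOX OF THE HALF-WINDOW MEMBER `β₁₃(θ₁₅ᶜᶜᴹᵂᶻᴮ(j; ½; εbg))` ON `]0, γ]`** (§5 transfer `betaLowerH∕betaUpperH_theta13OfThm1CCMWZB_of_half`).  These hypotheses are the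
WINDOWED TWO-SIDED BOX WITH LETTERS — dag-n21-c's 3ʷ text with `0 ≤ b` replaced by the letter `−b·γ² ≤ 3`.  CONDITIONAL.  (node O P3 g48 §4ʷ at Z3.) [cite: Balaban1987RG1, (1.20)–(1.22) p.264, (0.20) p.256, §1 p.264; Balaban1988Convergent, (2.4)–(2.8) pp.255–256] -/
theorem hcompBoth_theta13OfThm1CCMWZBAx_of_betaBoxSignFree_half (hγ : γ ≤ 1 / 2) (hB : 0 ≤ B₃) (hB' : 0 ≤ B₃') (ha₀ : 0 ≤ a₀) (ha₁ : 0 ≤ a₁) {bl β' : ℝ}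
    (hlow : BetaLowerH bl γ (betaOfRecord₁₃Ax F N (theta13OfThm1CCMWZBAx F N j (1 / 2) εbg ε₀ ε₂₉ B₃ B₃' a₀ a₁ Efl logz)))
    (hup : BetaUpperH β' γ (betaOfRecord₁₃Ax F N (theta13OfThm1CCMWZBAx F N j (1 / 2) εbg ε₀ ε₂₉ B₃ B₃' a₀ a₁ Efl logz))) (hl : -bl * γ ^ 2 ≤ 3) (hu : β' * γ ^ 2 ≤ 3 / 4) :
    (∀ (p : B12.RunParams) (n : ℕ), n ≤ p.K → Step.InInterval (theta13OfThm1CCMWZBAx F N j γ εbg ε₀ ε₂₉ B₃ B₃' a₀ a₁ Efl logz).γ n (gOfRecord₁₃Ax F N (theta13OfThm1CCMWZBAx F N j γ εbg ε₀ ε₂₉ B₃ B₃' a₀ a₁ Efl logz) p) → ∀ m, m < n →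
      (theta13OfThm1CCMWZBAx F N j γ εbg ε₀ ε₂₉ B₃ B₃' a₀ a₁ Efl logz).s2.cR * epsOfRecord (theta13OfThm1CCMWZBAx F N j γ εbg ε₀ ε₂₉ B₃ B₃' a₀ a₁ Efl logz).ν (gOfRecord₁₃Ax F N (theta13OfThm1CCMWZBAx F N j γ εbg ε₀ ε₂₉ B₃ B₃' a₀ a₁ Efl logz) p) m ≤ 2 * ((theta13OfThm1CCMWZBAx F N j γ εbg ε₀ ε₂₉ B₃ B₃' a₀ a₁ Efl logz).s2.cR * epsOfRecord (theta13OfThm1CCMWZBAx F N j γ εbg ε₀ ε₂₉ B₃ B₃' a₀ a₁ Efl logz).ν (gOfRecord₁₃Ax F N (theta13OfThm1CCMWZBAx F N j γ εbg ε₀ ε₂₉ B₃ B₃' a₀ a₁ Efl logz) p) (m + 1))) ∧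
    (∀ (p : B12.RunParams) (n : ℕ), n ≤ p.K → Step.InInterval (theta13OfThm1CCMWZBAx F N j γ εbg ε₀ ε₂₉ B₃ B₃' a₀ a₁ Efl logz).γ n (gOfRecord₁₃Ax F N (theta13OfThm1CCMWZBAx F N j γ εbg ε₀ ε₂₉ B₃ B₃' a₀ a₁ Efl logz) p) → ∀ m, m < n →
      (theta13OfThm1CCMWZBAx F N j γ εbg ε₀ ε₂₉ B₃ B₃' a₀ a₁ Efl logz).s2.cR * epsOfRecord (theta13OfThm1CCMWZBAx F N j γ εbg ε₀ ε₂₉ B₃ B₃' a₀ a₁ Efl logz).ν (gOfRecord₁₃Ax F N (theta13OfThm1CCMWZBAx F N j γ εbg ε₀ ε₂₉ B₃ B₃' a₀ a₁ Efl logz) p) (m + 1) ≤ 2 * ((theta13OfThm1CCMWZBAx F N j γ εbg ε₀ ε₂₉ B₃ B₃' a₀ a₁ Efl logz).s2.cR * epsOfRecord (theta13OfThm1CCMWZBAx F N j γ εbg ε₀ ε₂₉ B₃ B₃' a₀ a₁ Efl logz).ν (gOfRecord₁₃Ax F N (theta13OfThm1CCMWZBAx F N j γ εbg ε₀ ε₂₉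 B₃ B₃' a₀ a₁ Efl logz) p) m)) :=
  hcompBoth_theta13OfThm1CCMWZB_of_betaBoxSignFree_half_chi (χ := chiFixed29Ax F N (numerics7OfThm1CCM F.L j ε₀ B₃ B₃' a₀ a₁) ε₂₉) hγ hB hB' ha₀ ha₁ hlow hup hl hu

end SignFreeAx

end Literature.MathematicalPhysics.QuantumFieldTheory.Balaban1983to89.Node00

end
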